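import Mathlib
import HarnessLib
import Literature.Probability.MarkovChains.CoarseRicciCurvature
import Literature.Probability.MarkovChains.MixingTimeSubmultiplicative
import Literature.Probability.MarkovChains.TimeAverageConcentration

/-!
# Bias and variance of MCMC empirical means under positive coarse Ricci curvature (Joulin–Ollivier 2010: Prop. 1, eq. (5), Lemma 9, Thms. 2–3)

HONEST FRAMING: exact (Metropolis-corrected) sampling algorithms for lattice gauge theory; figures
of merit are autocorrelation/cost numbers at stated couplings and volumes; no continuum-physics claim.

The FINITE-STATE case of A. Joulin, Y. Ollivier, *Curvature, concentration and error estimates for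
Markov chain Monte Carlo*, Ann. Probab. 38 (2010) 2418–2442 [JoulinOllivier2010] (read on the
arXiv source 0904.1312), §1 (notation; standing assumption `W₁(P_x,P_y) ≤ (1 − κ)d(x,y)`, `κ > 0`),
§1.2 Proposition 1 (bias of empirical means, eq. (4)), eq. (5) / §4.2 Lemma 9 (the `N`-step variance
inequality (11) and the variance under the invariant law (12)), and Theorem 2 (variance of empirical
means, eq. (6)), in the vocabulary of `CoarseRicciCurvature.lean` (`coarseRicci ρ P x y = κ(x,y)`,
`transportDist ρ = W₁`), `PathCoupling.lean`, `TotalVariation.lean` (`lawAt`, `IsRowStochastic`),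
`MixingTimeSubmultiplicative.lean` (`kernelAt P t x y = Pᵗ(x,y)`) and `MetropolisHastings.lean`
(`IsStationary`).  Everything is PROVED (finite sums; 0 named facts); measurability and the
first-moment class `𝒫_d` of the paper are vacuous on a finite space.

* `iterMean P N f x = Pᴺf(x) = E_x f(X_N)` (the iterated averaging operator), `eccentricity ρ π x =
  E(x) = ∫ d(x,y) π(dy)`, `empiricalMeanExpectation P T₀ T f x = E_x π̂(f)` for the empirical mean
  **`π̂(f) = T⁻¹ Σ_{k=T₀+1}^{T₀+T} f(X_k)`** with burn-in `T₀` [cite: JoulinOllivier2010, §1.1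
  (notation: `PᴺF`, `π̂(f)`, eccentricity)];
* `iterMean_lipschitz` — **`Pᴺf` is `(1 − κ)ᴺ‖f‖_Lip`-Lipschitz** [cite: JoulinOllivier2010, §4.1
  ("recall from [Oll09] that … the function `Pᵏf` is `(1 − κ)ᵏ`-Lipschitz")], and
  `abs_iterMean_sub_stationaryMean_le` — `|Pᵏf(x) − π(f)| ≤ (1 − κ)ᵏ E(x) ‖f‖_Lip` (eq. (2));
* **PROPOSITION 1 (bias of empirical means)** `JoulinOllivier2010_prop_1`:
  **`|E_x π̂(f) − π(f)| ≤ (1 − κ)^{T₀+1}/(κT) · E(x) · ‖f‖_Lip`** [cite: JoulinOllivier2010, §1.2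
  Prop. 1, eq. (4); proof §4.1];
* `stepVariance P x g = P(g²)(x) − (Pg(x))²` and the STEP-VARIANCE BOUND `S` — the paper's
  `σ(x)²/n_x` enters only through its defining property "`Var_{P_x} g ≤ ‖g‖²_Lip σ(x)²/n_x` for every
  Lipschitz `g`" (definition of the local dimension `n_x`), which is taken as the hypothesis
  `IsStepVarianceBound ρ P S`; `coarseDiffusion ρ P x = σ(x)²` always qualifies
  (`isStepVarianceBound_coarseDiffusion`, i.e. `n_x ≥ 1`) [cite: JoulinOllivier2010, §1.1 (coarse
  diffusion constant `σ(x)²`, local dimension `n_x ≥ 1`)];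
* **LEMMA 9, eq. (11)** `JoulinOllivier2010_lemma_9`:
  **`Pᴺ(f²) − (Pᴺf)² ≤ ‖f‖²_Lip Σ_{k=0}^{N−1} (1 − κ)^{2(N−1−k)} Pᵏ(σ²/n)`** ("a simple induction
  argument") and **eq. (5) = (12)** `JoulinOllivier2010_eq_5`: **`Var_π f ≤ ‖f‖²_Lip sup_x σ(x)²/(n_x κ)`**
  (here: law of total variance under stationarity `stationaryVariance_split`, iterated, and
  `N → ∞`) [cite: JoulinOllivier2010, §4.2 Lemma 9, eqs. (11)–(12); §1.2 eq. (5)];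
* **THEOREM 2 (Variance of empirical means, 1), eq. (6)**: with `empMeanVariance P T f x = Var_x π̂(f)`
  (`T₀ = 0`) and `empMeanVarianceBurnIn P T₀ T f x` (burn-in `T₀`), both defined on the PATH LAW of the
  chain (`pathSum` of `PeskunOrdering.lean`, the joint law `p_{x i₁} p_{i₁ i₂} ⋯`),
  `JoulinOllivier2010_thm_2`: **`Var_x π̂(f) ≤ (‖f‖²_Lip/(κT)) sup_x σ(x)²/(n_xκ)`** for `T₀ = 0`, and
  `JoulinOllivier2010_thm_2_burnIn`: **`Var_x π̂(f) ≤ (‖f‖²_Lip/(κT))(1 + 1/(κT)) sup_x σ(x)²/(n_xκ)`**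
  otherwise.  Proof as printed, organised as a law-of-total-variance induction: conditioning on the
  FIRST step, `V_{T+1}(y) = Σ_z P(y,z)V_T(z) + Var_{P_y}(f + m_T)` (`sumVariance_succ`) where
  `f + m_T = Σ_{k=0}^{T} Pᵏf` is `‖f‖_Lip/κ`-Lipschitz (the paper's constants `s_k ≤ 1/(κT)`, times `T`;
  `lipschitz_sum_iterMean`), whence `V_T ≤ (‖f‖_Lip/κ)² Σ_{k<T} PᵏS` (`sumVariance_le`); the burn-in
  case adds, by the Markov property at time `T₀` (`pathSum_windowSum`, `empMeanVarianceBurnIn_eq`),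
  the variance of the `‖f‖_Lip/(κT)`-Lipschitz mean `y ↦ E_y π̂₀(f)` under `Pˣ^{T₀}`, bounded by Lemma 9
  [cite: JoulinOllivier2010, §1.2 Thm. 2, eq. (6); proof §4.2].

* **THEOREM 3 (Variance of empirical means, 2), eq. (7)**: for a `C`-Lipschitz `S` with
  `σ(x)²/(n_xκ) ≤ S(x)` and the invariant probability `π`, `JoulinOllivier2010_thm_3`:
  **`Var_x π̂(f) ≤ (‖f‖²_Lip/(κT)) (E_π S + (C/(κT)) E(x))`** for `T₀ = 0`, and
  `JoulinOllivier2010_thm_3_burnIn`: **`Var_x π̂(f) ≤ (‖f‖²_Lip/(κT)) ((1 + 1/(κT)) E_π S +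
  (2C(1−κ)^{T₀}/(κT)) E(x))`** for `T₀ ≥ 1`; steps as printed: `PᵏS ≤ E_π S + C(1−κ)ᵏE(x)`
  (`iterMean_le_stationaryMean_add`), the two geometric sums (`sum_geom_weights_le`), the semigroup
  property `Pᴹ Pᴺ = P^{M+N}` (`iterMean_iterMean`) and the sharper Lipschitz constant
  `(1−κ)L/(κT)` of `y ↦ E_y π̂₀(f)` (`lipschitz_empMean_sharp`) [cite: JoulinOllivier2010, §1.2
  Thm. 3, eq. (7); proof §4.2 (last display)].

SCOPE / `TODO(general form)`: Polish state spaces (where Theorem 3's unbounded `σ²/n` matters) and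
the concentration Theorems 4–5 are not treated; the paper conditions on the LAST coordinate (downward
induction on `f_{x_1,…,x_k}`), this file on the first step — the same inequalities in the same order,
and exactly the printed constants in (4), (5), (6), (11).  Context (cell pub-lqcd, venture
LatticeQCDFlow): these are NON-ASYMPTOTIC error bars for MCMC time averages of Lipschitz observables
from a contraction rate `κ` (the path-coupling constant of `PathCoupling.lean`, `1 − κ = e^{−α}`):
burn-in `T₀ ≳ 1/κ` kills the bias, and `κT` plays the role of the number of independent samples ("`T`
steps of the MCMC method are 'worth' only `κT` independent samples") — the curvature form of the
cell's `τ_int`/ESS accounting.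
-/

namespace Literature.Probability.MarkovChains

open Finset Matrix

variable {X : Type*} [Fintype X] [DecidableEq X]

/-! ## Notation: `Pᴺf`, eccentricity, the expected empirical mean -/

/-- The iterated averaging operator **`Pᴺf(x) = E_x f(X_N) = Σ_y Pᴺ(x,y) f(y)`**.
[cite: JoulinOllivier2010, §1.1 ("define the iterated averaging operator as `PᴺF(x) := E_x f(X_N)`")] -/
def iterMean (P : Matrix X X ℝ) (N : ℕ) (f : X → ℝ) (x : X) : ℝ := ∑ y, kernelAt P N x y * f y

/-- The **eccentricity** `E(x) := ∫ d(x,y) π(dy)`. [cite: JoulinOllivier2010, §1.1 (eccentricity)] -/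
def eccentricity (ρ : X → X → ℝ) (π : X → ℝ) (x : X) : ℝ := ∑ y, ρ x y * π y

/-- **`E_x π̂(f) = T⁻¹ Σ_{k=T₀+1}^{T₀+T} Pᵏf(x)`**, the expectation of the empirical mean
`π̂(f) := T⁻¹ Σ_{k=T₀+1}^{T₀+T} f(X_k)` of the chain started at `x` (burn-in `T₀`, `T` samples).
[cite: JoulinOllivier2010, §1.1 (definition of `π̂(f)`), §4.1 (first display)] -/
noncomputable def empiricalMeanExpectation (P : Matrix X X ℝ) (T₀ T : ℕ) (f : X → ℝ) (x : X) : ℝ :=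
  (T : ℝ)⁻¹ * ∑ k ∈ Ico (T₀ + 1) (T₀ + T + 1), iterMean P k f x

section Basic

variable {P : Matrix X X ℝ}

/-- `P⁰f = f`. [cite: JoulinOllivier2010, §1.1 (`Pˣ⁰ = δ_x`)] -/
theorem iterMean_zero (f : X → ℝ) (x : X) : iterMean P 0 f x = f x := by
  unfold iterMean kernelAt
  simp only [lawAt_zero]
  rw [Finset.sum_eq_single x]
  · simp
  · intro y _ hy; simp [hy]
  · exact fun h => (h (mem_univ _)).elim

/-- The first-step recursion **`P^{N+1}f(x) = Σ_z P(x,z) Pᴺf(z)`**. [cite: JoulinOllivier2010, §1.1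
(the inductive definition of `Pˣᴺ`)] -/
theorem iterMean_succ (N : ℕ) (f : X → ℝ) (x : X) :
    iterMean P (N + 1) f x = ∑ z, P x z * iterMean P N f z := by
  unfold iterMean kernelAt
  have h : lawAt P (Pi.single x 1) (N + 1) = lawAt P (lawAt P (Pi.single x 1) 1) N := by
    rw [add_comm, lawAt_add]
  simp_rw [h, lawAt_eq_stepLaw_kernelAt P (lawAt P (Pi.single x 1) 1) N]
  unfold stepLaw
  have h1 : ∀ z, lawAt P (Pi.single x 1) 1 z = P x z := fun z => by
    rw [show (1 : ℕ) = 0 + 1 from rfl, lawAt_succ, lawAt_zero, stepLaw_single_apply]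
  simp_rw [h1, sum_mul, mul_sum]
  rw [sum_comm]
  exact sum_congr rfl fun z _ => sum_congr rfl fun y _ => by unfold kernelAt; ring

/-- `Pᴺf(x) = E_{δ_x Pᴺ} f` as a `lawAt` mean. [cite: JoulinOllivier2010, §1.1] -/
theorem iterMean_eq_sum_lawAt (N : ℕ) (f : X → ℝ) (x : X) :
    iterMean P N f x = ∑ y, lawAt P (Pi.single x 1) N y * f y := rfl

/-- Linearity: `Pᴺ(f + g) = Pᴺf + Pᴺg`, `Pᴺ(cf) = cPᴺf`, and monotonicity / constants for a
row-stochastic `P`. [cite: JoulinOllivier2010, §1.1 (the averaging operator)] -/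
theorem iterMean_add (N : ℕ) (f g : X → ℝ) (x : X) :
    iterMean P N (fun y => f y + g y) x = iterMean P N f x + iterMean P N g x := by
  unfold iterMean; simp_rw [mul_add]; rw [sum_add_distrib]

/-- `Pᴺ(cf) = cPᴺf`. [cite: JoulinOllivier2010, §1.1 (the averaging operator `Pᴺ` is linear)] -/
theorem iterMean_const_mul (N : ℕ) (c : ℝ) (f : X → ℝ) (x : X) :
    iterMean P N (fun y => c * f y) x = c * iterMean P N f x := by
  unfold iterMean; rw [mul_sum]; exact sum_congr rfl fun y _ => by ring

/-- `Pᴺc = c` for a row-stochastic `P`. [cite: JoulinOllivier2010, §1.1 (`Pᴺ` of a constant)] -/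
theorem iterMean_const (hP : IsRowStochastic P) (N : ℕ) (c : ℝ) (x : X) :
    iterMean P N (fun _ => c) x = c := by
  unfold iterMean; rw [← sum_mul, sum_kernelAt hP, one_mul]

/-- `f ≤ g ⇒ Pᴺf ≤ Pᴺg` (`Pᴺ(x,·) ≥ 0`). [cite: JoulinOllivier2010, §1.1 (`Pᴺ` is an averaging
operator)] -/
theorem iterMean_mono (hP : IsRowStochastic P) (N : ℕ) {f g : X → ℝ} (h : ∀ y, f y ≤ g y) (x : X) :
    iterMean P N f x ≤ iterMean P N g x :=
  sum_le_sum fun y _ => mul_le_mul_of_nonneg_left (h y) ((kernelAt_isRowStochastic hP N).1 x y)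

end Basic

/-! ## `Pᴺf` is `(1 − κ)ᴺ‖f‖_Lip`-Lipschitz; the bias of one sample (eq. (2)) -/

section Curvature

variable {ρ : X → X → ℝ} {P : Matrix X X ℝ}

omit [Fintype X] in
/-- Point masses are probability vectors (plumbing). [folklore] -/
private theorem single_nonneg' (x a : X) : 0 ≤ (Pi.single x 1 : X → ℝ) a := by
  rw [Pi.single_apply]; split_ifs <;> norm_num

/-- Point masses have total mass one (plumbing). [folklore] -/
private theorem sum_single' (x : X) : ∑ a, (Pi.single x 1 : X → ℝ) a = 1 := by
  rw [Finset.sum_pi_single']; simp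

/-- **`Pᴺf` is `(1 − κ)ᴺ‖f‖_Lip`-Lipschitz** when `κ(x,y) ≥ κ` for all pairs:
`|Pᴺf(x) − Pᴺf(y)| ≤ (1 − κ)ᴺ L d(x,y)` for an `L`-Lipschitz `f` (`|E_μf − E_μ'f| ≤ L W₁(μ,μ')` and
`W₁(δ_xPᴺ, δ_yPᴺ) ≤ (1 − κ)ᴺ W₁(δ_x,δ_y) = (1 − κ)ᴺ d(x,y)`). [cite: JoulinOllivier2010, §4.1
("recall from [Oll09] that for `k ∈ ℕ`, the function `Pᵏf` is `(1 − κ)ᵏ`-Lipschitz")] -/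
theorem iterMean_lipschitz (hP : IsRowStochastic P) (hρ : ∀ a b, 0 ≤ ρ a b) (hρ0 : ∀ a, ρ a a = 0)
    (hρpos : ∀ a b, a ≠ b → 0 < ρ a b) {κ : ℝ} (hκ1 : κ ≤ 1)
    (hκxy : ∀ x y, x ≠ y → κ ≤ coarseRicci ρ P x y) {f : X → ℝ} {L : ℝ}
    (hf : ∀ a b, |f a - f b| ≤ L * ρ a b) (N : ℕ) (x y : X) :
    |iterMean P N f x - iterMean P N f y| ≤ (1 - κ) ^ N * L * ρ x y := by
  by_cases hxy : x = y
  · subst hxy; simp [hρ0]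
  rw [iterMean_eq_sum_lawAt, iterMean_eq_sum_lawAt]
  have hx := single_nonneg' (X := X) x
  have hy := single_nonneg' (X := X) y
  have hL : 0 ≤ L :=
    nonneg_of_mul_nonneg_left ((abs_nonneg _).trans (hf x y)) (hρpos x y hxy)
  calc |∑ a, lawAt P (Pi.single x 1) N a * f a - ∑ b, lawAt P (Pi.single y 1) N b * f b|
      ≤ L * transportDist ρ (lawAt P (Pi.single x 1) N) (lawAt P (Pi.single y 1) N) :=
        abs_lawMean_sub_le_transportDist hf (couplings_nonempty (lawAt_nonneg hP hx N)
          (lawAt_nonneg hP hy N) (by rw [sum_lawAt hP, sum_single']) (by rw [sum_lawAt hP, sum_single']))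
    _ ≤ L * ((1 - κ) ^ N * transportDist ρ (Pi.single x 1) (Pi.single y 1)) :=
        mul_le_mul_of_nonneg_left (transportDist_lawAt_le hP (by linarith)
          (fun a b ha hb ha1 hb1 => Ollivier2009_prop_3 hP hρ hρ0 hρpos hκxy ha hb ha1 hb1)
          hx hy (sum_single' x) (sum_single' y) N) hL
    _ = (1 - κ) ^ N * L * ρ x y := by rw [transportDist_single_single]; ring

/-- **Eq. (2)**: `W₁(Pˣᴺ, π) ≤ (1 − κ)ᴺ E(x)`, in the form used for the bias:
**`|Pᴺf(x) − π(f)| ≤ (1 − κ)ᴺ E(x) ‖f‖_Lip`**. [cite: JoulinOllivier2010, §1.1 eq. (2) with §4.1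
(proof of Prop. 1: "by the invariance of `π` … `≤ (1 − κ)ᵏ ∫ d(x,y)π(dy)`")] -/
theorem abs_iterMean_sub_stationaryMean_le (hP : IsRowStochastic P) (hρ : ∀ a b, 0 ≤ ρ a b)
    (hρ0 : ∀ a, ρ a a = 0) (hρpos : ∀ a b, a ≠ b → 0 < ρ a b) {κ : ℝ} (hκ1 : κ ≤ 1)
    (hκxy : ∀ x y, x ≠ y → κ ≤ coarseRicci ρ P x y) {π : X → ℝ} (hπ : ∀ a, 0 ≤ π a)
    (hπ1 : ∑ a, π a = 1) (hπP : IsStationary π P) {f : X → ℝ} {L : ℝ}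
    (hf : ∀ a b, |f a - f b| ≤ L * ρ a b) (hL : 0 ≤ L) (N : ℕ) (x : X) :
    |iterMean P N f x - ∑ y, π y * f y| ≤ (1 - κ) ^ N * eccentricity ρ π x * L := by
  rw [iterMean_eq_sum_lawAt]
  have hx := single_nonneg' (X := X) x
  calc |∑ a, lawAt P (Pi.single x 1) N a * f a - ∑ y, π y * f y|
      ≤ L * transportDist ρ (lawAt P (Pi.single x 1) N) π :=
        abs_lawMean_sub_le_transportDist hf (couplings_nonempty (lawAt_nonneg hP hx N) hπ
          (by rw [sum_lawAt hP, sum_single']) hπ1)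
    _ ≤ L * ((1 - κ) ^ N * transportDist ρ (Pi.single x 1) π) :=
        mul_le_mul_of_nonneg_left
          (Ollivier2009_cor_1_convergence hP hρ hρ0 hρpos hκ1 hκxy hx (sum_single' x) hπ hπ1 hπP N) hL
    _ = (1 - κ) ^ N * eccentricity ρ π x * L := by
        rw [transportDist_single_left ρ x hπ hπ1, eccentricity]; ring

/-- **PROPOSITION 1 (Bias of empirical means).** Under the standing assumption `κ(x,y) ≥ κ > 0`,
for any Lipschitz `f`, burn-in `T₀` and `T ≥ 1` samples,
**`|E_x π̂(f) − π(f)| ≤ (1 − κ)^{T₀+1}/(κT) · E(x) · ‖f‖_Lip`** (eq. (4)).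
[cite: JoulinOllivier2010, §1.2 Prop. 1, eq. (4); proof §4.1] -/
theorem JoulinOllivier2010_prop_1 (hP : IsRowStochastic P) (hρ : ∀ a b, 0 ≤ ρ a b)
    (hρ0 : ∀ a, ρ a a = 0) (hρpos : ∀ a b, a ≠ b → 0 < ρ a b) {κ : ℝ} (hκ0 : 0 < κ) (hκ1 : κ ≤ 1)
    (hκxy : ∀ x y, x ≠ y → κ ≤ coarseRicci ρ P x y) {π : X → ℝ} (hπ : ∀ a, 0 ≤ π a)
    (hπ1 : ∑ a, π a = 1) (hπP : IsStationary π P) {f : X → ℝ} {L : ℝ}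
    (hf : ∀ a b, |f a - f b| ≤ L * ρ a b) (hL : 0 ≤ L) {T₀ T : ℕ} (hT : 0 < T) (x : X) :
    |empiricalMeanExpectation P T₀ T f x - ∑ y, π y * f y| ≤
      (1 - κ) ^ (T₀ + 1) / (κ * T) * eccentricity ρ π x * L := by
  have hT' : (0 : ℝ) < T := by exact_mod_cast hT
  have hE : 0 ≤ eccentricity ρ π x := sum_nonneg fun y _ => mul_nonneg (hρ x y) (hπ y)
  have hcard : (Ico (T₀ + 1) (T₀ + T + 1)).card = T := by simp
  -- `E_x π̂(f) − π(f) = T⁻¹ Σ_k (Pᵏf(x) − π(f))`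
  have h1 : empiricalMeanExpectation P T₀ T f x - ∑ y, π y * f y =
      (T : ℝ)⁻¹ * ∑ k ∈ Ico (T₀ + 1) (T₀ + T + 1), (iterMean P k f x - ∑ y, π y * f y) := by
    rw [empiricalMeanExpectation, sum_sub_distrib, sum_const, hcard, nsmul_eq_mul, mul_sub,
      ← mul_assoc, inv_mul_cancel₀ hT'.ne', one_mul]
  rw [h1, abs_mul, abs_of_pos (inv_pos.2 hT')]
  -- termwise eq. (2), then the geometric sum `Σ_{k=T₀+1}^{T₀+T} (1−κ)ᵏ ≤ (1−κ)^{T₀+1}/κ`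
  have h2 : |∑ k ∈ Ico (T₀ + 1) (T₀ + T + 1), (iterMean P k f x - ∑ y, π y * f y)| ≤
      (∑ k ∈ Ico (T₀ + 1) (T₀ + T + 1), (1 - κ) ^ k) * (eccentricity ρ π x * L) := by
    refine (abs_sum_le_sum_abs _ _).trans ?_
    rw [sum_mul]
    refine sum_le_sum fun k _ => ?_
    rw [← mul_assoc]
    exact abs_iterMean_sub_stationaryMean_le hP hρ hρ0 hρpos hκ1 hκxy hπ hπ1 hπP hf hL k x
  have h3 : ∑ k ∈ Ico (T₀ + 1) (T₀ + T + 1), (1 - κ) ^ k ≤ (1 - κ) ^ (T₀ + 1) / κ := by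
    have h := geom_sum_Ico_le_of_lt_one (m := T₀ + 1) (n := T₀ + T + 1) (x := 1 - κ)
      (by linarith) (by linarith)
    rwa [sub_sub_cancel] at h
  calc (T : ℝ)⁻¹ * |∑ k ∈ Ico (T₀ + 1) (T₀ + T + 1), (iterMean P k f x - ∑ y, π y * f y)|
      ≤ (T : ℝ)⁻¹ * ((1 - κ) ^ (T₀ + 1) / κ * (eccentricity ρ π x * L)) :=
        mul_le_mul_of_nonneg_left (h2.trans (mul_le_mul_of_nonneg_right h3 (mul_nonneg hE hL)))
          (inv_nonneg.2 hT'.le)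
    _ = (1 - κ) ^ (T₀ + 1) / (κ * T) * eccentricity ρ π x * L := by
        field_simp

/-! ## The one-step variance bound `σ(x)²/n_x` and Lemma 9 -/

/-- The **coarse diffusion constant** `σ(x)² := ½ ∬ d(y,z)² P_x(dy)P_x(dz)`.
[cite: JoulinOllivier2010, §1.1 (coarse diffusion constant)] -/
noncomputable def coarseDiffusion (ρ : X → X → ℝ) (P : Matrix X X ℝ) (x : X) : ℝ :=
  (1 / 2) * ∑ y, ∑ z, ρ y z ^ 2 * (P x y * P x z)

/-- The one-step variance `Var_{P_x} g = P(g²)(x) − (Pg(x))²`. [cite: JoulinOllivier2010, §4.2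
(Lemma 9 with `N = 1`: `P(f²) − (Pf)²`)] -/
def stepVariance (P : Matrix X X ℝ) (x : X) (g : X → ℝ) : ℝ :=
  ∑ y, P x y * g y ^ 2 - (∑ y, P x y * g y) ^ 2

/-- `S` bounds the one-step variance of Lipschitz functions: `Var_{P_x} g ≤ ‖g‖²_Lip S(x)` for every
`L`-Lipschitz `g` — the defining property of `σ(x)²/n_x` (the local dimension `n_x` is the infimum
over 1-Lipschitz `f` of `∬ d(y,z)² P_x P_x / ∬ |f(y) − f(z)|² P_x P_x`, so that `S = σ²/n` is the least
such bound), and the hypothesis `σ(x)²/n_x ≤ S(x)` of Theorem 3. [cite: JoulinOllivier2010, §1.1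
(local dimension `n_x`), §1.2 Thm. 3 (hypothesis `σ(x)²/n_x ≤ S(x)`)] -/
def IsStepVarianceBound (ρ : X → X → ℝ) (P : Matrix X X ℝ) (S : X → ℝ) : Prop :=
  ∀ (x : X) (g : X → ℝ) (L : ℝ), 0 ≤ L → (∀ a b, |g a - g b| ≤ L * ρ a b) →
    stepVariance P x g ≤ L ^ 2 * S x

omit [DecidableEq X] in
/-- `Var_{P_x} g = ½ ∬ (g(y) − g(z))² P_x(dy)P_x(dz)` for a probability vector `P(x,·)`.
[cite: JoulinOllivier2010, §1.1 (the denominator `∬ |f(y) − f(z)|² P_x P_x` in the definition of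
`n_x`)] -/
theorem stepVariance_eq_half_sum (hP : IsRowStochastic P) (x : X) (g : X → ℝ) :
    stepVariance P x g = (1 / 2) * ∑ y, ∑ z, (g y - g z) ^ 2 * (P x y * P x z) := by
  unfold stepVariance
  have A : ∑ y, ∑ z, (g y - g z) ^ 2 * (P x y * P x z) =
      ∑ y, ∑ z, (P x y * g y ^ 2) * P x z + ∑ y, ∑ z, P x y * (P x z * g z ^ 2) -
        2 * ∑ y, ∑ z, (P x y * g y) * (P x z * g z) := by
    rw [← sum_add_distrib, mul_sum, ← sum_sub_distrib]
    refine sum_congr rfl fun y _ => ?_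
    rw [← sum_add_distrib, mul_sum, ← sum_sub_distrib]
    refine sum_congr rfl fun z _ => ?_
    ring
  have B1 : ∑ y, ∑ z, (P x y * g y ^ 2) * P x z = ∑ y, P x y * g y ^ 2 := by
    refine sum_congr rfl fun y _ => ?_
    rw [← mul_sum, hP.2 x, mul_one]
  have B2 : ∑ y, ∑ z, P x y * (P x z * g z ^ 2) = ∑ z, P x z * g z ^ 2 := by
    rw [← sum_mul_sum, hP.2 x, one_mul]
  have B3 : ∑ y, ∑ z, (P x y * g y) * (P x z * g z) = (∑ y, P x y * g y) ^ 2 := by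
    rw [← sum_mul_sum, sq]
  rw [A, B1, B2, B3]
  ring

omit [DecidableEq X] in
/-- **`n_x ≥ 1`**: `σ(x)²` itself bounds the one-step variance of Lipschitz functions
(`|g(y) − g(z)| ≤ ‖g‖_Lip d(y,z)` inside `½∬`). [cite: JoulinOllivier2010, §1.1 ("`n_x ≥ 1`"; "The
bound `n_x ≥ 1` is often sufficient for application to graphs")] -/
theorem isStepVarianceBound_coarseDiffusion (hP : IsRowStochastic P) :
    IsStepVarianceBound ρ P (coarseDiffusion ρ P) := by
  intro x g L hL hg
  rw [stepVariance_eq_half_sum hP, coarseDiffusion]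
  have key : ∑ y, ∑ z, (g y - g z) ^ 2 * (P x y * P x z) ≤
      ∑ y, ∑ z, (L ^ 2 * ρ y z ^ 2) * (P x y * P x z) := by
    refine sum_le_sum fun y _ => sum_le_sum fun z _ =>
      mul_le_mul_of_nonneg_right ?_ (mul_nonneg (hP.1 x y) (hP.1 x z))
    have h := hg y z
    calc (g y - g z) ^ 2 = |g y - g z| ^ 2 := (sq_abs _).symm
      _ ≤ (L * ρ y z) ^ 2 := pow_le_pow_left₀ (abs_nonneg _) h 2
      _ = L ^ 2 * ρ y z ^ 2 := by ring
  have e : ∑ y, ∑ z, (L ^ 2 * ρ y z ^ 2) * (P x y * P x z) =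
      L ^ 2 * ∑ y, ∑ z, ρ y z ^ 2 * (P x y * P x z) := by
    rw [mul_sum]
    refine sum_congr rfl fun y _ => ?_
    rw [mul_sum]
    exact sum_congr rfl fun z _ => by ring
  rw [e] at key
  linarith

/-- **LEMMA 9, eq. (11).** For every `N` and every Lipschitz `f`,
**`Pᴺ(f²) − (Pᴺf)² ≤ ‖f‖²_Lip Σ_{k=0}^{N−1} (1 − κ)^{2(N−1−k)} Pᵏ(σ²/n)`** ("The proof relies on a
simple induction argument": `P^{N+1}(f²) − (P^{N+1}f)² = P[Pᴺ(f²) − (Pᴺf)²] + Var_P(Pᴺf)` and `Pᴺf` is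
`(1 − κ)ᴺ‖f‖_Lip`-Lipschitz), with `σ²/n` any step-variance bound `S`. [cite: JoulinOllivier2010,
§4.2 Lemma 9, eq. (11)] -/
theorem JoulinOllivier2010_lemma_9 (hP : IsRowStochastic P) (hρ : ∀ a b, 0 ≤ ρ a b)
    (hρ0 : ∀ a, ρ a a = 0) (hρpos : ∀ a b, a ≠ b → 0 < ρ a b) {κ : ℝ} (hκ1 : κ ≤ 1)
    (hκxy : ∀ x y, x ≠ y → κ ≤ coarseRicci ρ P x y) {S : X → ℝ} (hS : IsStepVarianceBound ρ P S)
    {f : X → ℝ} {L : ℝ} (hf : ∀ a b, |f a - f b| ≤ L * ρ a b) (hL : 0 ≤ L) (N : ℕ) (x : X) :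
    iterMean P N (fun y => f y ^ 2) x - iterMean P N f x ^ 2 ≤
      L ^ 2 * ∑ k ∈ range N, (1 - κ) ^ (2 * (N - 1 - k)) * iterMean P k S x := by
  induction N generalizing x with
  | zero => simp [iterMean_zero]
  | succ N ih =>
    rw [iterMean_succ, iterMean_succ]
    -- `P^{N+1}(f²) − (P^{N+1}f)² = Σ_z P(x,z)[Pᴺ(f²)(z) − (Pᴺf(z))²] + Var_{P_x}(Pᴺf)`
    have hsplit : ∑ z, P x z * iterMean P N (fun y => f y ^ 2) z - (∑ z, P x z * iterMean P N f z) ^ 2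
        = ∑ z, P x z * (iterMean P N (fun y => f y ^ 2) z - iterMean P N f z ^ 2) +
          stepVariance P x (iterMean P N f) := by
      unfold stepVariance
      simp_rw [mul_sub, sum_sub_distrib]
      ring
    rw [hsplit]
    -- the induction hypothesis under `P(x,·)`
    have h1 : ∑ z, P x z * (iterMean P N (fun y => f y ^ 2) z - iterMean P N f z ^ 2) ≤
        ∑ z, P x z * (L ^ 2 * ∑ k ∈ range N, (1 - κ) ^ (2 * (N - 1 - k)) * iterMean P k S z) :=
      sum_le_sum fun z _ => mul_le_mul_of_nonneg_left (ih z) (hP.1 x z)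
    -- the one-step variance of the `(1 − κ)ᴺL`-Lipschitz function `Pᴺf`
    have h2 : stepVariance P x (iterMean P N f) ≤ ((1 - κ) ^ N * L) ^ 2 * S x :=
      hS x _ _ (mul_nonneg (pow_nonneg (by linarith) N) hL)
        (fun a b => iterMean_lipschitz hP hρ hρ0 hρpos hκ1 hκxy hf N a b)
    -- `Σ_z P(x,z) PᵏS(z) = P^{k+1}S(x)`
    have h3 : ∑ z, P x z * (L ^ 2 * ∑ k ∈ range N, (1 - κ) ^ (2 * (N - 1 - k)) * iterMean P k S z)
        = L ^ 2 * ∑ k ∈ range N, (1 - κ) ^ (2 * (N - 1 - k)) * iterMean P (k + 1) S x := by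
      have inner : ∀ k, ∑ z, P x z * (L ^ 2 * ((1 - κ) ^ (2 * (N - 1 - k)) * iterMean P k S z)) =
          L ^ 2 * ((1 - κ) ^ (2 * (N - 1 - k)) * ∑ z, P x z * iterMean P k S z) := by
        intro k
        rw [Finset.mul_sum, Finset.mul_sum]
        exact sum_congr rfl fun z _ => by ring
      have step1 : ∀ z, P x z * (L ^ 2 * ∑ k ∈ range N, (1 - κ) ^ (2 * (N - 1 - k)) * iterMean P k S z)
          = ∑ k ∈ range N, P x z * (L ^ 2 * ((1 - κ) ^ (2 * (N - 1 - k)) * iterMean P k S z)) := by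
        intro z
        rw [Finset.mul_sum, Finset.mul_sum]
      simp_rw [step1]
      rw [sum_comm]
      simp_rw [inner, iterMean_succ]
      rw [← Finset.mul_sum]
    rw [h3] at h1
    -- the target sum, split off its `k = 0` term
    have h4 : L ^ 2 * ∑ k ∈ range (N + 1), (1 - κ) ^ (2 * (N + 1 - 1 - k)) * iterMean P k S x =
        L ^ 2 * ∑ k ∈ range N, (1 - κ) ^ (2 * (N - 1 - k)) * iterMean P (k + 1) S x +
          ((1 - κ) ^ N * L) ^ 2 * S x := by
      rw [sum_range_succ', iterMean_zero, mul_add]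
      congr 1
      · congr 1
        refine sum_congr rfl fun k hk => ?_
        rw [mem_range] at hk
        congr 2
        omega
      · rw [show N + 1 - 1 - 0 = N from by omega, mul_pow, ← pow_mul, mul_comm 2 N]; ring
    rw [h4]
    linarith

/-! ## Eq. (5) = (12): the variance of a Lipschitz function under the invariant law -/

/-- `P¹g(x) = Σ_z P(x,z) g(z)`. [cite: JoulinOllivier2010, §1.1 (`Pˣ¹ := P_x`)] -/
theorem iterMean_one (g : X → ℝ) (x : X) : iterMean P 1 g x = ∑ z, P x z * g z := by
  rw [show (1 : ℕ) = 0 + 1 from rfl, iterMean_succ]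
  simp_rw [iterMean_zero]

omit [DecidableEq X] in
/-- A step-variance bound is nonnegative (test it on a constant function). [cite:
JoulinOllivier2010, §1.1 (`σ(x)², n_x` are nonnegative quantities)] -/
theorem IsStepVarianceBound.nonneg (hρ : ∀ a b, 0 ≤ ρ a b) {S : X → ℝ}
    (hS : IsStepVarianceBound ρ P S) (x : X) : 0 ≤ S x := by
  have h := hS x (fun _ => (0 : ℝ)) 1 zero_le_one (fun a b => by simpa using hρ a b)
  simp only [stepVariance, one_pow, one_mul] at h
  simpa using h

/-- The mean `π(g) = Σ_y π(y) g(y)` is invariant under one step for a stationary `π`: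
`π(g) = π(Pg)`. [cite: JoulinOllivier2010, §1.1 ("`π` is said to be invariant … if `π = πP`")] -/
theorem stationaryMean_iterMean_one {π : X → ℝ} (hπP : IsStationary π P) (g : X → ℝ) :
    ∑ y, π y * g y = ∑ x, π x * iterMean P 1 g x := by
  simp_rw [iterMean_one, mul_sum, ← mul_assoc]
  rw [sum_comm]
  refine sum_congr rfl fun y _ => ?_
  rw [← sum_mul, hπP y]


/-- **Law of total variance under stationarity**: `Var_π f = π(Var_{P_·} f) + Var_π(Pf)`.
[cite: JoulinOllivier2010, §4.2 (Lemma 9: "letting `N` tend to infinity … entails a variance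
estimate under the invariant measure"; the one-step decomposition behind the induction)] -/
theorem stationaryVariance_split {π : X → ℝ} (hπP : IsStationary π P) (f : X → ℝ) :
    ∑ y, π y * f y ^ 2 - (∑ y, π y * f y) ^ 2 =
      ∑ x, π x * stepVariance P x f +
        (∑ x, π x * iterMean P 1 f x ^ 2 - (∑ x, π x * iterMean P 1 f x) ^ 2) := by
  rw [stationaryMean_iterMean_one hπP (fun y => f y ^ 2), stationaryMean_iterMean_one hπP f]
  unfold stepVariance
  simp_rw [iterMean_one, mul_sub, sum_sub_distrib]
  ring

/-- Iterating the split: **`Var_π f ≤ L² π(S) Σ_{k<N} (1 − κ)^{2k} + Var_π(Pᴺf)`** for every `N`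
(`Pᵏf` is `(1 − κ)ᵏL`-Lipschitz). [cite: JoulinOllivier2010, §4.2 Lemma 9 (the induction, run under
`π`)] -/
theorem stationaryVariance_le_iterate (hP : IsRowStochastic P) (hρ : ∀ a b, 0 ≤ ρ a b)
    (hρ0 : ∀ a, ρ a a = 0) (hρpos : ∀ a b, a ≠ b → 0 < ρ a b) {κ : ℝ} (hκ1 : κ ≤ 1)
    (hκxy : ∀ x y, x ≠ y → κ ≤ coarseRicci ρ P x y) {π : X → ℝ} (hπ : ∀ a, 0 ≤ π a)
    (hπP : IsStationary π P) {S : X → ℝ} (hS : IsStepVarianceBound ρ P S)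
    {f : X → ℝ} {L : ℝ} (hf : ∀ a b, |f a - f b| ≤ L * ρ a b) (hL : 0 ≤ L) (N : ℕ) :
    ∑ y, π y * f y ^ 2 - (∑ y, π y * f y) ^ 2 ≤
      L ^ 2 * (∑ x, π x * S x) * ∑ k ∈ range N, ((1 - κ) ^ 2) ^ k +
        (∑ y, π y * iterMean P N f y ^ 2 - (∑ y, π y * iterMean P N f y) ^ 2) := by
  induction N with
  | zero => simp [iterMean_zero]
  | succ N ih =>
    -- split the variance of the `(1 − κ)ᴺL`-Lipschitz function `Pᴺf`
    have hsplit := stationaryVariance_split (P := P) hπP (iterMean P N f)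
    have hstep : ∑ x, π x * stepVariance P x (iterMean P N f) ≤
        ∑ x, π x * (((1 - κ) ^ N * L) ^ 2 * S x) :=
      sum_le_sum fun x _ => mul_le_mul_of_nonneg_left
        (hS x _ _ (mul_nonneg (pow_nonneg (by linarith) N) hL)
          (fun a b => iterMean_lipschitz hP hρ hρ0 hρpos hκ1 hκxy hf N a b)) (hπ x)
    have hP1 : ∀ y, iterMean P 1 (iterMean P N f) y = iterMean P (N + 1) f y := by
      intro y; rw [iterMean_one, iterMean_succ]
    simp_rw [hP1] at hsplit
    have e : ∑ x, π x * (((1 - κ) ^ N * L) ^ 2 * S x) =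
        L ^ 2 * (∑ x, π x * S x) * ((1 - κ) ^ 2) ^ N := by
      rw [mul_sum, sum_mul]
      refine sum_congr rfl fun x _ => ?_
      rw [← pow_mul, mul_comm 2 N, pow_mul]
      ring
    rw [sum_range_succ, mul_add]
    linarith [ih, hsplit, hstep, e]

omit [DecidableEq X] in
/-- `Var_π g ≤ L_g² · ½∬ d² dπ dπ` for an `L_g`-Lipschitz `g` (the invariant law as a one-row kernel).
[cite: JoulinOllivier2010, §1.1 (`n_x ≥ 1` applied to the kernel `x ↦ π`)] -/
theorem stationaryVariance_le_lipschitz {π : X → ℝ} (hπ : ∀ a, 0 ≤ π a)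
    (hπ1 : ∑ a, π a = 1) {g : X → ℝ} {L : ℝ} (hg : ∀ a b, |g a - g b| ≤ L * ρ a b) (hL : 0 ≤ L)
    (x : X) :
    ∑ y, π y * g y ^ 2 - (∑ y, π y * g y) ^ 2 ≤
      L ^ 2 * coarseDiffusion ρ (fun _ y => π y : Matrix X X ℝ) x := by
  have hQ : IsRowStochastic (fun (_ : X) (y : X) => π y : Matrix X X ℝ) := ⟨fun _ y => hπ y, fun _ => hπ1⟩
  have h := isStepVarianceBound_coarseDiffusion (ρ := ρ) hQ x g L hL hg
  simpa [stepVariance] using h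

/-- **Eq. (5) = (12) (variance under the invariant law).** If `Var_{P_x} g ≤ ‖g‖²_Lip S(x)` for all
Lipschitz `g` (i.e. `σ(x)²/n_x ≤ S(x)`) and `S ≤ B`, then for every `L`-Lipschitz `f`,
**`Var_π f ≤ L² B/κ`** — the printed `Var_π f ≤ ‖f‖²_Lip sup_x σ(x)²/(n_x κ)`. (Proof: the bound
of `stationaryVariance_le_iterate` is `≤ L²B/(κ(2 − κ)) + (1 − κ)^{2N} L² · ½∬d²dπdπ` for every `N`;
let `N → ∞`.) [cite: JoulinOllivier2010, §1.2 eq. (5); §4.2 Lemma 9, eq. (12)] -/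
theorem JoulinOllivier2010_eq_5 (hP : IsRowStochastic P) (hρ : ∀ a b, 0 ≤ ρ a b)
    (hρ0 : ∀ a, ρ a a = 0) (hρpos : ∀ a b, a ≠ b → 0 < ρ a b) {κ : ℝ} (hκ0 : 0 < κ) (hκ1 : κ ≤ 1)
    (hκxy : ∀ x y, x ≠ y → κ ≤ coarseRicci ρ P x y) {π : X → ℝ} (hπ : ∀ a, 0 ≤ π a)
    (hπ1 : ∑ a, π a = 1) (hπP : IsStationary π P) {S : X → ℝ} (hS : IsStepVarianceBound ρ P S)
    {B : ℝ} (hSB : ∀ x, S x ≤ B) {f : X → ℝ} {L : ℝ} (hf : ∀ a b, |f a - f b| ≤ L * ρ a b)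
    (hL : 0 ≤ L) :
    ∑ y, π y * f y ^ 2 - (∑ y, π y * f y) ^ 2 ≤ L ^ 2 * B / κ := by
  -- `X` is nonempty (`Σ π = 1`)
  obtain ⟨x₀⟩ : Nonempty X := by
    by_contra h
    rw [not_nonempty_iff] at h
    simp at hπ1
  set r : ℝ := (1 - κ) ^ 2 with hr
  have hr0 : 0 ≤ r := sq_nonneg _
  have hr1 : r < 1 := by
    rw [hr, sq_lt_one_iff_abs_lt_one, abs_lt]; constructor <;> linarith
  set D : ℝ := coarseDiffusion ρ (fun _ y => π y : Matrix X X ℝ) x₀ with hD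
  have hπS : ∑ x, π x * S x ≤ B := by
    calc ∑ x, π x * S x ≤ ∑ x, π x * B := sum_le_sum fun x _ => mul_le_mul_of_nonneg_left (hSB x) (hπ x)
      _ = B := by rw [← sum_mul, hπ1, one_mul]
  have hπS0 : 0 ≤ ∑ x, π x * S x := sum_nonneg fun x _ => mul_nonneg (hπ x) (hS.nonneg hρ x)
  -- for every `N`: `Var_π f ≤ L²B/(1 − r) + rᴺ L² D`
  have hN : ∀ N : ℕ, ∑ y, π y * f y ^ 2 - (∑ y, π y * f y) ^ 2 ≤
      L ^ 2 * B / (1 - r) + r ^ N * (L ^ 2 * D) := by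
    intro N
    have h1 := stationaryVariance_le_iterate hP hρ hρ0 hρpos hκ1 hκxy hπ hπP hS hf hL N
    have h2 : ∑ k ∈ range N, r ^ k ≤ 1 / (1 - r) := by
      have h := geom_sum_Ico_le_of_lt_one (m := 0) (n := N) hr0 hr1
      rwa [← range_eq_Ico, pow_zero] at h
    have h3 : ∑ y, π y * iterMean P N f y ^ 2 - (∑ y, π y * iterMean P N f y) ^ 2 ≤
        ((1 - κ) ^ N * L) ^ 2 * D :=
      stationaryVariance_le_lipschitz hπ hπ1
        (fun a b => iterMean_lipschitz hP hρ hρ0 hρpos hκ1 hκxy hf N a b)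
        (mul_nonneg (pow_nonneg (by linarith) N) hL) x₀
    have h4 : ((1 - κ) ^ N * L) ^ 2 * D = r ^ N * (L ^ 2 * D) := by
      rw [hr, ← pow_mul, mul_comm 2 N, pow_mul]; ring
    have h5 : L ^ 2 * (∑ x, π x * S x) * ∑ k ∈ range N, r ^ k ≤ L ^ 2 * B / (1 - r) := by
      calc L ^ 2 * (∑ x, π x * S x) * ∑ k ∈ range N, r ^ k
          ≤ L ^ 2 * B * (1 / (1 - r)) :=
            mul_le_mul (mul_le_mul_of_nonneg_left hπS (sq_nonneg L)) h2
              (sum_nonneg fun k _ => pow_nonneg hr0 k) (mul_nonneg (sq_nonneg L)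
                (hπS0.trans hπS))
        _ = L ^ 2 * B / (1 - r) := by ring
    linarith
  -- let `N → ∞`
  have hlim : Filter.Tendsto (fun N : ℕ => L ^ 2 * B / (1 - r) + r ^ N * (L ^ 2 * D))
      Filter.atTop (nhds (L ^ 2 * B / (1 - r))) := by
    have h := ((tendsto_pow_atTop_nhds_zero_of_lt_one hr0 hr1).mul_const (L ^ 2 * D)).const_add
      (L ^ 2 * B / (1 - r))
    simpa using h
  have hle := ge_of_tendsto' hlim hN
  -- `1 − r = κ(2 − κ) ≥ κ`
  have hB : 0 ≤ B := (hS.nonneg hρ x₀).trans (hSB x₀)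
  have hkr : κ ≤ 1 - r := by rw [hr]; nlinarith
  calc ∑ y, π y * f y ^ 2 - (∑ y, π y * f y) ^ 2 ≤ L ^ 2 * B / (1 - r) := hle
    _ ≤ L ^ 2 * B / κ :=
        div_le_div_of_nonneg_left (mul_nonneg (sq_nonneg L) hB) hκ0 hkr

end Curvature

/-! ## Theorem 2: the variance of the empirical mean (no burn-in) -/

/-- `Σ_{i=1}^T f(X_i)` as a functional of the trajectory `ω = (X_1,…,X_T)`.
[cite: JoulinOllivier2010, §1.1 (the empirical mean `π̂(f)`, times `T`)] -/
def sumAlong (T : ℕ) (f : X → ℝ) (ω : Fin T → X) : ℝ := ∑ i, f (ω i)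

/-- **`Var_x π̂(f)`** for `T₀ = 0`: `E_x[π̂(f)²] − (E_x π̂(f))²` with `π̂(f) = T⁻¹Σ_{k=1}^T f(X_k)`, the
expectations being the path expectations `pathSum` of the chain started at `x`.
[cite: JoulinOllivier2010, §1.2 ("where `Var_x π̂(f) := E_x[|π̂(f) − E_x π̂(f)|²]`")] -/
noncomputable def empMeanVariance (P : Matrix X X ℝ) (T : ℕ) (f : X → ℝ) (x : X) : ℝ :=
  pathSum P T x (fun ω => ((T : ℝ)⁻¹ * sumAlong T f ω) ^ 2) -
    pathSum P T x (fun ω => (T : ℝ)⁻¹ * sumAlong T f ω) ^ 2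

/-- The unnormalised variance `V_T(x) = E_x[(Σ_{i≤T} f(X_i))²] − (E_x Σ_{i≤T} f(X_i))²`.
[cite: JoulinOllivier2010, §4.2 (proof of Thm. 2)] -/
noncomputable def sumVariance (P : Matrix X X ℝ) (T : ℕ) (f : X → ℝ) (x : X) : ℝ :=
  pathSum P T x (fun ω => sumAlong T f ω ^ 2) - pathSum P T x (sumAlong T f) ^ 2

section PathFunctionals

variable {ρ : X → X → ℝ} {P : Matrix X X ℝ}

omit [DecidableEq X] in
/-- Linearity of the path expectation (sums). [folklore] [cite: JoulinOllivier2010, §1.1] -/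
private theorem pathSum_add'' (P : Matrix X X ℝ) (n : ℕ) :
    ∀ (x : X) (F G : (Fin n → X) → ℝ),
      pathSum P n x (fun ω => F ω + G ω) = pathSum P n x F + pathSum P n x G := by
  induction n with
  | zero => intro x F G; rfl
  | succ n ih =>
    intro x F G
    simp only [pathSum_succ]
    rw [← sum_add_distrib]
    exact sum_congr rfl fun y _ => by rw [ih]; ring

omit [DecidableEq X] in
/-- Linearity of the path expectation (scalars). [folklore] [cite: JoulinOllivier2010, §1.1] -/
private theorem pathSum_const_mul'' (P : Matrix X X ℝ) (n : ℕ) :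
    ∀ (x : X) (c : ℝ) (F : (Fin n → X) → ℝ),
      pathSum P n x (fun ω => c * F ω) = c * pathSum P n x F := by
  induction n with
  | zero => intro x c F; rfl
  | succ n ih =>
    intro x c F
    simp only [pathSum_succ]
    rw [mul_sum]
    exact sum_congr rfl fun y _ => by rw [ih]; ring


omit [DecidableEq X] in
omit [Fintype X] in
/-- Peeling the first step of the sum: `Σ_{i≤T+1} f(X_i) = f(X_1) + Σ_{i≤T} f(X_{i+1})`.
[cite: JoulinOllivier2010, §1.1] -/
theorem sumAlong_vecCons (T : ℕ) (f : X → ℝ) (z : X) (ω : Fin T → X) :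
    sumAlong (T + 1) f (vecCons z ω) = f z + sumAlong T f ω := by
  unfold sumAlong
  rw [Fin.sum_univ_succ]
  simp

/-- **`E_x Σ_{i≤T} f(X_i) = Σ_{k=1}^T Pᵏf(x)`**. [cite: JoulinOllivier2010, §4.1 (first display:
`E_x π̂(f) = T⁻¹ Σ_k Pᵏf(x)`)] -/
theorem pathSum_sumAlong (hP : IsRowStochastic P) (T : ℕ) (f : X → ℝ) (x : X) :
    pathSum P T x (sumAlong T f) = ∑ k ∈ range T, iterMean P (k + 1) f x := by
  unfold sumAlong
  rw [pathSum_ergodicSum hP T x f, Finset.sum_range (fun k => iterMean P (k + 1) f x)]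
  refine sum_congr rfl fun i _ => ?_
  rw [iterMean, Matrix.mulVec, dotProduct]
  exact sum_congr rfl fun y _ => by rw [kernelAt_eq_pow_apply]

/-- `E_x π̂(f)` (path form, `T₀ = 0`) is the kernel form `empiricalMeanExpectation P 0 T f x`.
[cite: JoulinOllivier2010, §4.1 (first display)] -/
theorem pathSum_empMean (hP : IsRowStochastic P) (T : ℕ) (f : X → ℝ) (x : X) :
    pathSum P T x (fun ω => (T : ℝ)⁻¹ * sumAlong T f ω) = empiricalMeanExpectation P 0 T f x := by
  rw [pathSum_const_mul'', pathSum_sumAlong hP, empiricalMeanExpectation, Finset.sum_Ico_eq_sum_range]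
  congr 1
  rw [show 0 + T + 1 - (0 + 1) = T from by omega]
  refine sum_congr rfl fun k _ => ?_
  rw [show 0 + 1 + k = k + 1 from by omega]

omit [DecidableEq X] in
/-- `Var_x π̂(f) = T⁻² V_T(x)`. [cite: JoulinOllivier2010, §4.2 (proof of Thm. 2)] -/
theorem empMeanVariance_eq (T : ℕ) (f : X → ℝ) (x : X) :
    empMeanVariance P T f x = (T : ℝ)⁻¹ ^ 2 * sumVariance P T f x := by
  unfold empMeanVariance sumVariance
  have h : (fun ω : Fin T → X => ((T : ℝ)⁻¹ * sumAlong T f ω) ^ 2) =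
      fun ω => (T : ℝ)⁻¹ ^ 2 * sumAlong T f ω ^ 2 := funext fun ω => by ring
  rw [h, pathSum_const_mul'', pathSum_const_mul'']
  ring

omit [DecidableEq X] in
/-- **The first-step (law of total variance) recursion**:
`V_{T+1}(y) = Σ_z P(y,z) V_T(z) + Var_{P_y}(f + m_T)` with `m_T(z) = E_z Σ_{i≤T} f(X_i)`.
[cite: JoulinOllivier2010, §4.2 proof of Thm. 2 (the downward induction on conditional
expectations; here conditioned on the FIRST step)] -/
theorem sumVariance_succ (hP : IsRowStochastic P) (T : ℕ) (f : X → ℝ) (y : X) :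
    sumVariance P (T + 1) f y = ∑ z, P y z * sumVariance P T f z +
      stepVariance P y (fun z => f z + pathSum P T z (sumAlong T f)) := by
  unfold sumVariance stepVariance
  rw [pathSum_succ, pathSum_succ]
  simp_rw [sumAlong_vecCons]
  have h2 : ∀ z, pathSum P T z (fun ω => (f z + sumAlong T f ω) ^ 2) =
      f z ^ 2 + 2 * f z * pathSum P T z (sumAlong T f) +
        pathSum P T z (fun ω => sumAlong T f ω ^ 2) := by
    intro z
    have e : (fun ω : Fin T → X => (f z + sumAlong T f ω) ^ 2) =
        fun ω => (f z ^ 2 + 2 * f z * sumAlong T f ω) + sumAlong T f ω ^ 2 := funext fun ω => by ring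
    rw [e, pathSum_add'', pathSum_add'', pathSum_const hP, pathSum_const_mul'']
  have h1 : ∀ z, pathSum P T z (fun ω => f z + sumAlong T f ω) = f z + pathSum P T z (sumAlong T f) := by
    intro z
    rw [pathSum_add'', pathSum_const hP]
  simp_rw [h2, h1, add_sq, mul_add, mul_sub, sum_add_distrib, sum_sub_distrib]
  ring

/-- The function `z ↦ f(z) + E_z Σ_{i≤T} f(X_i) = Σ_{k=0}^{T} Pᵏf(z)` is `L/κ`-Lipschitz
(`Σ_k (1 − κ)ᵏ ≤ 1/κ`): the constants `s_k ≤ 1/(κT)` of the paper, times `T`.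
[cite: JoulinOllivier2010, §4.2 proof of Thm. 2 ("`f_{x_1,…,x_{k−1}}` is Lipschitz with constant
`s_k := T⁻¹ Σ_{j=0}^{T−k} (1 − κ)ʲ ≤ 1/(κT)`")] -/
theorem lipschitz_sum_iterMean (hP : IsRowStochastic P) (hρ : ∀ a b, 0 ≤ ρ a b)
    (hρ0 : ∀ a, ρ a a = 0) (hρpos : ∀ a b, a ≠ b → 0 < ρ a b) {κ : ℝ} (hκ0 : 0 < κ) (hκ1 : κ ≤ 1)
    (hκxy : ∀ x y, x ≠ y → κ ≤ coarseRicci ρ P x y) {f : X → ℝ} {L : ℝ}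
    (hf : ∀ a b, |f a - f b| ≤ L * ρ a b) (hL : 0 ≤ L) (T : ℕ) (a b : X) :
    |(f a + pathSum P T a (sumAlong T f)) - (f b + pathSum P T b (sumAlong T f))| ≤
      L / κ * ρ a b := by
  rw [pathSum_sumAlong hP, pathSum_sumAlong hP]
  -- `Σ_{k=0}^{T} Pᵏf`
  have e : ∀ c, f c + ∑ k ∈ range T, iterMean P (k + 1) f c = ∑ k ∈ range (T + 1), iterMean P k f c := by
    intro c; rw [sum_range_succ', iterMean_zero, add_comm]
  rw [e, e, ← sum_sub_distrib]
  refine (abs_sum_le_sum_abs _ _).trans ?_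
  calc ∑ k ∈ range (T + 1), |iterMean P k f a - iterMean P k f b|
      ≤ ∑ k ∈ range (T + 1), (1 - κ) ^ k * L * ρ a b :=
        sum_le_sum fun k _ => iterMean_lipschitz hP hρ hρ0 hρpos hκ1 hκxy hf k a b
    _ = (∑ k ∈ range (T + 1), (1 - κ) ^ k) * (L * ρ a b) := by rw [sum_mul]; exact sum_congr rfl fun k _ => by ring
    _ ≤ (1 / κ) * (L * ρ a b) := by
        refine mul_le_mul_of_nonneg_right ?_ (mul_nonneg hL (hρ a b))
        have h := geom_sum_Ico_le_of_lt_one (m := 0) (n := T + 1) (x := 1 - κ) (by linarith) (by linarith)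
        rw [← range_eq_Ico, pow_zero, sub_sub_cancel] at h
        exact h
    _ = L / κ * ρ a b := by ring

/-- **`V_T(x) ≤ (L/κ)² Σ_{k<T} PᵏS(x)`** by unrolling the first-step recursion.
[cite: JoulinOllivier2010, §4.2 proof of Thm. 2 (the chain of inequalities ending in
`(1/(κ²T²)) Σ_k Pᵏ(σ²/n)(x)`)] -/
theorem sumVariance_le (hP : IsRowStochastic P) (hρ : ∀ a b, 0 ≤ ρ a b)
    (hρ0 : ∀ a, ρ a a = 0) (hρpos : ∀ a b, a ≠ b → 0 < ρ a b) {κ : ℝ} (hκ0 : 0 < κ) (hκ1 : κ ≤ 1)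
    (hκxy : ∀ x y, x ≠ y → κ ≤ coarseRicci ρ P x y) {S : X → ℝ} (hS : IsStepVarianceBound ρ P S)
    {f : X → ℝ} {L : ℝ} (hf : ∀ a b, |f a - f b| ≤ L * ρ a b) (hL : 0 ≤ L) (T : ℕ) (x : X) :
    sumVariance P T f x ≤ (L / κ) ^ 2 * ∑ k ∈ range T, iterMean P k S x := by
  induction T generalizing x with
  | zero => simp [sumVariance, pathSum, sumAlong]
  | succ T ih =>
    rw [sumVariance_succ hP]
    have h1 : ∑ z, P x z * sumVariance P T f z ≤
        ∑ z, P x z * ((L / κ) ^ 2 * ∑ k ∈ range T, iterMean P k S z) :=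
      sum_le_sum fun z _ => mul_le_mul_of_nonneg_left (ih z) (hP.1 x z)
    have h2 : stepVariance P x (fun z => f z + pathSum P T z (sumAlong T f)) ≤ (L / κ) ^ 2 * S x :=
      hS x _ _ (div_nonneg hL hκ0.le)
        (fun a b => lipschitz_sum_iterMean hP hρ hρ0 hρpos hκ0 hκ1 hκxy hf hL T a b)
    have h3 : ∑ z, P x z * ((L / κ) ^ 2 * ∑ k ∈ range T, iterMean P k S z) =
        (L / κ) ^ 2 * ∑ k ∈ range T, iterMean P (k + 1) S x := by
      have inner : ∀ k, ∑ z, P x z * ((L / κ) ^ 2 * iterMean P k S z) =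
          (L / κ) ^ 2 * ∑ z, P x z * iterMean P k S z := by
        intro k; rw [Finset.mul_sum]; exact sum_congr rfl fun z _ => by ring
      have step1 : ∀ z, P x z * ((L / κ) ^ 2 * ∑ k ∈ range T, iterMean P k S z) =
          ∑ k ∈ range T, P x z * ((L / κ) ^ 2 * iterMean P k S z) := by
        intro z; rw [Finset.mul_sum, Finset.mul_sum]
      simp_rw [step1]
      rw [sum_comm]
      simp_rw [inner, iterMean_succ]
      rw [← Finset.mul_sum]
    rw [h3] at h1
    have h4 : (L / κ) ^ 2 * ∑ k ∈ range (T + 1), iterMean P k S x =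
        (L / κ) ^ 2 * ∑ k ∈ range T, iterMean P (k + 1) S x + (L / κ) ^ 2 * S x := by
      rw [sum_range_succ', iterMean_zero, mul_add]
    rw [h4]
    linarith

/-- **THEOREM 2 (Variance of empirical means, 1), case `T₀ = 0`.** Under `κ(x,y) ≥ κ > 0` and a
step-variance bound `σ(x)²/n_x ≤ S(x) ≤ B`, for an `L`-Lipschitz `f` and `T ≥ 1` samples,
**`Var_x π̂(f) ≤ (L²/(κT)) · (B/κ)`** — the printed `‖f‖²_Lip/(κT) · sup_x σ(x)²/(n_xκ)`.
[cite: JoulinOllivier2010, §1.2 Thm. 2, eq. (6) (case `T₀ = 0`); proof §4.2] -/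
theorem JoulinOllivier2010_thm_2 (hP : IsRowStochastic P) (hρ : ∀ a b, 0 ≤ ρ a b)
    (hρ0 : ∀ a, ρ a a = 0) (hρpos : ∀ a b, a ≠ b → 0 < ρ a b) {κ : ℝ} (hκ0 : 0 < κ) (hκ1 : κ ≤ 1)
    (hκxy : ∀ x y, x ≠ y → κ ≤ coarseRicci ρ P x y) {S : X → ℝ} (hS : IsStepVarianceBound ρ P S)
    {B : ℝ} (hSB : ∀ x, S x ≤ B) {f : X → ℝ} {L : ℝ} (hf : ∀ a b, |f a - f b| ≤ L * ρ a b)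
    (hL : 0 ≤ L) {T : ℕ} (hT : 0 < T) (x : X) :
    empMeanVariance P T f x ≤ L ^ 2 / (κ * T) * (B / κ) := by
  have hT' : (0 : ℝ) < T := by exact_mod_cast hT
  rw [empMeanVariance_eq]
  have h1 := sumVariance_le hP hρ hρ0 hρpos hκ0 hκ1 hκxy hS hf hL T x
  have h2 : ∑ k ∈ range T, iterMean P k S x ≤ T * B := by
    calc ∑ k ∈ range T, iterMean P k S x ≤ ∑ k ∈ range T, B :=
          sum_le_sum fun k _ => (iterMean_mono hP k hSB x).trans (le_of_eq (iterMean_const hP k B x))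
      _ = T * B := by rw [sum_const, card_range, nsmul_eq_mul]
  calc (T : ℝ)⁻¹ ^ 2 * sumVariance P T f x ≤ (T : ℝ)⁻¹ ^ 2 * ((L / κ) ^ 2 * (T * B)) :=
        mul_le_mul_of_nonneg_left (h1.trans (mul_le_mul_of_nonneg_left h2 (sq_nonneg _)))
          (sq_nonneg _)
    _ = L ^ 2 / (κ * T) * (B / κ) := by field_simp

/-! ## Theorem 2 with burn-in `T₀`: the Markov property at time `T₀` -/

/-- The empirical mean with burn-in as a functional of the trajectory `(X_1,…,X_{T₀+T})`
(indexed as `Fin (T + T₀)`): `Σ_{j<T} f(X_{T₀+1+j})`. [cite: JoulinOllivier2010, §1.1 (definition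
of `π̂(f) := T⁻¹ Σ_{k=T₀+1}^{T₀+T} f(X_k)`)] -/
def windowSum (T₀ T : ℕ) (f : X → ℝ) (ω : Fin (T + T₀) → X) : ℝ :=
  ∑ j : Fin T, f (ω ⟨T₀ + j, by omega⟩)

/-- **`Var_x π̂(f)`** with burn-in `T₀`: `E_x[π̂(f)²] − (E_x π̂(f))²` on the path law of
`(X_1,…,X_{T₀+T})`. [cite: JoulinOllivier2010, §1.2 (definition of `Var_x π̂(f)`)] -/
noncomputable def empMeanVarianceBurnIn (P : Matrix X X ℝ) (T₀ T : ℕ) (f : X → ℝ) (x : X) : ℝ :=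
  pathSum P (T + T₀) x (fun ω => ((T : ℝ)⁻¹ * windowSum T₀ T f ω) ^ 2) -
    pathSum P (T + T₀) x (fun ω => (T : ℝ)⁻¹ * windowSum T₀ T f ω) ^ 2

omit [Fintype X] [DecidableEq X] in
/-- Shifting the window past the first step. [cite: JoulinOllivier2010, §1.1] -/
theorem windowSum_vecCons (T₀ T : ℕ) (f : X → ℝ) (z : X) (ω : Fin (T + T₀) → X) :
    windowSum (T₀ + 1) T f (vecCons z ω : Fin (T + T₀ + 1) → X) = windowSum T₀ T f ω := by
  unfold windowSum
  refine sum_congr rfl fun j _ => ?_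
  have h : (⟨T₀ + 1 + (j : ℕ), by omega⟩ : Fin (T + T₀ + 1)) = Fin.succ ⟨T₀ + j, by omega⟩ :=
    Fin.ext (by simp; omega)
  rw [h, cons_val_succ]

omit [Fintype X] [DecidableEq X] in
/-- With no burn-in the window is the whole trajectory. [cite: JoulinOllivier2010, §1.1] -/
theorem windowSum_zero (T : ℕ) (f : X → ℝ) (ω : Fin (T + 0) → X) :
    windowSum 0 T f ω = sumAlong T f ω := by
  unfold windowSum sumAlong
  refine sum_congr rfl fun j _ => ?_
  exact congrArg f (congrArg ω (Fin.ext (by simp)))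

/-- First-step recursion of the `t`-step kernel: `P^{t+1}(x,y) = Σ_z P(x,z) Pᵗ(z,y)`.
[cite: JoulinOllivier2010, §1.1 (the inductive definition of `Pˣᴺ`)] -/
theorem kernelAt_succ_apply' (P : Matrix X X ℝ) (t : ℕ) (x y : X) :
    kernelAt P (t + 1) x y = ∑ z, P x z * kernelAt P t z y := by
  rw [kernelAt_eq_pow_apply, pow_succ', Matrix.mul_apply]
  exact sum_congr rfl fun z _ => by rw [kernelAt_eq_pow_apply]

/-- **Markov property at time `T₀`** for a functional of the window `(X_{T₀+1},…,X_{T₀+T})`: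
`E_x[G(X_{T₀+1},…,X_{T₀+T})] = Σ_y P^{T₀}(x,y) E_y[G(X_1,…,X_T)]`. [cite: JoulinOllivier2010, §1.2
(the discussion before Thm. 2: "if the burn-in `T₀` is large enough, then the law of `X_{T₀}` will be
close to … `π` so that `Var_x π̂(f)` will behave like `Var_{X₀∼π} π̂(f)`")] -/
theorem pathSum_windowSum (T : ℕ) (F : ℝ → ℝ) (f : X → ℝ) :
    ∀ (T₀ : ℕ) (x : X), pathSum P (T + T₀) x (fun ω => F (windowSum T₀ T f ω)) =
      ∑ y, kernelAt P T₀ x y * pathSum P T y (fun ω => F (sumAlong T f ω)) := by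
  intro T₀
  induction T₀ with
  | zero =>
    intro x
    simp_rw [windowSum_zero]
    show pathSum P T x (fun ω => F (sumAlong T f ω)) =
      iterMean P 0 (fun y => pathSum P T y fun ω => F (sumAlong T f ω)) x
    rw [iterMean_zero]
  | succ T₀ ih =>
    intro x
    rw [show pathSum P (T + (T₀ + 1)) x (fun ω => F (windowSum (T₀ + 1) T f ω)) =
      ∑ z, P x z * pathSum P (T + T₀) z (fun ω => F (windowSum (T₀ + 1) T f (vecCons z ω)))
      from pathSum_succ _ _ _ _]
    simp_rw [windowSum_vecCons, ih, kernelAt_succ_apply' P T₀ x, sum_mul, mul_sum]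
    rw [sum_comm]
    exact sum_congr rfl fun y _ => sum_congr rfl fun z _ => by ring

/-- `Var_x π̂(f) = Σ_y P^{T₀}(x,y) Var_y π̂₀(f) + [P^{T₀}(m²)(x) − (P^{T₀}m(x))²]` with `π̂₀` the
no-burn-in empirical mean from `y` and `m(y) = E_y π̂₀(f)` (law of total variance at time `T₀`).
[cite: JoulinOllivier2010, §4.2 proof of Thm. 2 (the last two displays: the `Σ_{k≤T₀}` term is
the variance of `f_∅` under `Pˣ^{T₀+1}`)] -/
theorem empMeanVarianceBurnIn_eq (T₀ T : ℕ) (f : X → ℝ) (x : X) :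
    empMeanVarianceBurnIn P T₀ T f x =
      iterMean P T₀ (empMeanVariance P T f) x +
        (iterMean P T₀ (fun y => pathSum P T y (fun ω => (T : ℝ)⁻¹ * sumAlong T f ω) ^ 2) x -
          iterMean P T₀ (fun y => pathSum P T y (fun ω => (T : ℝ)⁻¹ * sumAlong T f ω)) x ^ 2) := by
  unfold empMeanVarianceBurnIn empMeanVariance
  rw [pathSum_windowSum T (fun s => ((T : ℝ)⁻¹ * s) ^ 2) f T₀ x,
    pathSum_windowSum T (fun s => (T : ℝ)⁻¹ * s) f T₀ x]
  unfold iterMean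
  simp_rw [mul_sub, sum_sub_distrib]
  ring

/-- The no-burn-in mean `y ↦ E_y π̂₀(f) = T⁻¹ Σ_{k=1}^T Pᵏf(y)` is `L/(κT)`-Lipschitz.
[cite: JoulinOllivier2010, §4.2 proof of Thm. 2 ("`f_∅` … Lipschitz with constant `s_1 ≤ 1/(κT)`")] -/
theorem lipschitz_empMean (hP : IsRowStochastic P) (hρ : ∀ a b, 0 ≤ ρ a b)
    (hρ0 : ∀ a, ρ a a = 0) (hρpos : ∀ a b, a ≠ b → 0 < ρ a b) {κ : ℝ} (hκ0 : 0 < κ) (hκ1 : κ ≤ 1)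
    (hκxy : ∀ x y, x ≠ y → κ ≤ coarseRicci ρ P x y) {f : X → ℝ} {L : ℝ}
    (hf : ∀ a b, |f a - f b| ≤ L * ρ a b) (hL : 0 ≤ L) {T : ℕ} (hT : 0 < T) (a b : X) :
    |pathSum P T a (fun ω => (T : ℝ)⁻¹ * sumAlong T f ω) -
        pathSum P T b (fun ω => (T : ℝ)⁻¹ * sumAlong T f ω)| ≤ L / (κ * T) * ρ a b := by
  have hT' : (0 : ℝ) < T := by exact_mod_cast hT
  rw [pathSum_const_mul'', pathSum_const_mul'', pathSum_sumAlong hP, pathSum_sumAlong hP, ← mul_sub,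
    abs_mul, abs_of_pos (inv_pos.2 hT'), ← sum_sub_distrib]
  refine (mul_le_mul_of_nonneg_left (abs_sum_le_sum_abs _ _) (inv_nonneg.2 hT'.le)).trans ?_
  have h1 : ∑ k ∈ range T, |iterMean P (k + 1) f a - iterMean P (k + 1) f b| ≤
      (∑ k ∈ range T, (1 - κ) ^ (k + 1)) * (L * ρ a b) := by
    rw [sum_mul]
    refine sum_le_sum fun k _ => ?_
    have := iterMean_lipschitz hP hρ hρ0 hρpos hκ1 hκxy hf (k + 1) a b
    linarith
  have h2 : ∑ k ∈ range T, (1 - κ) ^ (k + 1) ≤ 1 / κ := by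
    have h := geom_sum_Ico_le_of_lt_one (m := 1) (n := T + 1) (x := 1 - κ) (by linarith) (by linarith)
    rw [Finset.sum_Ico_eq_sum_range, show T + 1 - 1 = T from by omega, pow_one, sub_sub_cancel] at h
    have e : ∑ k ∈ range T, (1 - κ) ^ (1 + k) = ∑ k ∈ range T, (1 - κ) ^ (k + 1) :=
      sum_congr rfl fun k _ => by rw [add_comm]
    rw [e] at h
    exact h.trans (div_le_div_of_nonneg_right (by linarith) hκ0.le)
  calc (T : ℝ)⁻¹ * ∑ k ∈ range T, |iterMean P (k + 1) f a - iterMean P (k + 1) f b|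
      ≤ (T : ℝ)⁻¹ * ((1 / κ) * (L * ρ a b)) :=
        mul_le_mul_of_nonneg_left (h1.trans (mul_le_mul_of_nonneg_right h2
          (mul_nonneg hL (hρ a b)))) (inv_nonneg.2 hT'.le)
    _ = L / (κ * T) * ρ a b := by field_simp

/-- **THEOREM 2 (Variance of empirical means, 1), general burn-in `T₀`.** Under `κ(x,y) ≥ κ > 0`
and `σ(x)²/n_x ≤ S(x) ≤ B`, for an `L`-Lipschitz `f`, `T ≥ 1`,
**`Var_x π̂(f) ≤ (L²/(κT)) (1 + 1/(κT)) (B/κ)`** — the printed "otherwise" case of eq. (6).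
[cite: JoulinOllivier2010, §1.2 Thm. 2, eq. (6) (case `T₀ ≠ 0`); proof §4.2] -/
theorem JoulinOllivier2010_thm_2_burnIn (hP : IsRowStochastic P) (hρ : ∀ a b, 0 ≤ ρ a b)
    (hρ0 : ∀ a, ρ a a = 0) (hρpos : ∀ a b, a ≠ b → 0 < ρ a b) {κ : ℝ} (hκ0 : 0 < κ) (hκ1 : κ ≤ 1)
    (hκxy : ∀ x y, x ≠ y → κ ≤ coarseRicci ρ P x y) {S : X → ℝ} (hS : IsStepVarianceBound ρ P S)
    {B : ℝ} (hSB : ∀ x, S x ≤ B) {f : X → ℝ} {L : ℝ} (hf : ∀ a b, |f a - f b| ≤ L * ρ a b)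
    (hL : 0 ≤ L) (T₀ : ℕ) {T : ℕ} (hT : 0 < T) (x : X) :
    empMeanVarianceBurnIn P T₀ T f x ≤ L ^ 2 / (κ * T) * (1 + 1 / (κ * T)) * (B / κ) := by
  have hT' : (0 : ℝ) < T := by exact_mod_cast hT
  have hB : 0 ≤ B := by
    obtain ⟨x₀⟩ : Nonempty X := ⟨x⟩
    exact (hS.nonneg hρ x).trans (hSB x)
  rw [empMeanVarianceBurnIn_eq]
  -- first term: the no-burn-in variance averaged over `P^{T₀}(x,·)`
  have h1 : iterMean P T₀ (empMeanVariance P T f) x ≤ L ^ 2 / (κ * T) * (B / κ) :=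
    (iterMean_mono hP T₀ (fun y => JoulinOllivier2010_thm_2 hP hρ hρ0 hρpos hκ0 hκ1 hκxy hS hSB hf
      hL hT y) x).trans (le_of_eq (iterMean_const hP T₀ _ x))
  -- second term: Lemma 9 at `N = T₀` for the `L/(κT)`-Lipschitz mean `y ↦ E_y π̂₀(f)`
  have h2 := JoulinOllivier2010_lemma_9 hP hρ hρ0 hρpos hκ1 hκxy hS
    (lipschitz_empMean hP hρ hρ0 hρpos hκ0 hκ1 hκxy hf hL hT)
    (div_nonneg hL (mul_nonneg hκ0.le hT'.le)) T₀ x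
  set r : ℝ := (1 - κ) ^ 2 with hr
  have hr0 : 0 ≤ r := sq_nonneg _
  have hr1 : r < 1 := by
    rw [hr, sq_lt_one_iff_abs_lt_one, abs_lt]; constructor <;> linarith
  have h3 : ∑ k ∈ range T₀, (1 - κ) ^ (2 * (T₀ - 1 - k)) * iterMean P k S x ≤ B / κ := by
    have hk : ∀ k ∈ range T₀, (1 - κ) ^ (2 * (T₀ - 1 - k)) * iterMean P k S x ≤
        r ^ (T₀ - 1 - k) * B := by
      intro k _
      rw [pow_mul, ← hr]
      exact mul_le_mul_of_nonneg_left
        ((iterMean_mono hP k hSB x).trans (le_of_eq (iterMean_const hP k B x))) (pow_nonneg hr0 _)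
    refine (sum_le_sum hk).trans ?_
    rw [← sum_mul, Finset.sum_range_reflect (fun j => r ^ j) T₀]
    have hg : ∑ j ∈ range T₀, r ^ j ≤ 1 / (1 - r) := by
      have h := geom_sum_Ico_le_of_lt_one (m := 0) (n := T₀) hr0 hr1
      rwa [← range_eq_Ico, pow_zero] at h
    have hkr : κ ≤ 1 - r := by rw [hr]; nlinarith
    calc (∑ j ∈ range T₀, r ^ j) * B ≤ 1 / (1 - r) * B := mul_le_mul_of_nonneg_right hg hB
      _ ≤ 1 / κ * B := mul_le_mul_of_nonneg_right
          (div_le_div_of_nonneg_left zero_le_one hκ0 hkr) hB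
      _ = B / κ := by ring
  have h4 : (L / (κ * T)) ^ 2 * ∑ k ∈ range T₀, (1 - κ) ^ (2 * (T₀ - 1 - k)) * iterMean P k S x ≤
      (L / (κ * T)) ^ 2 * (B / κ) := mul_le_mul_of_nonneg_left h3 (sq_nonneg _)
  have e : L ^ 2 / (κ * T) * (1 + 1 / (κ * T)) * (B / κ) =
      L ^ 2 / (κ * T) * (B / κ) + (L / (κ * T)) ^ 2 * (B / κ) := by
    field_simp
  rw [e]
  -- `P^{T₀}(g²) − (P^{T₀} g)²` in `iterMean` form
  have h5 : iterMean P T₀ (fun y => pathSum P T y (fun ω => (T : ℝ)⁻¹ * sumAlong T f ω) ^ 2) x -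
      iterMean P T₀ (fun y => pathSum P T y (fun ω => (T : ℝ)⁻¹ * sumAlong T f ω)) x ^ 2 ≤
      (L / (κ * T)) ^ 2 * (B / κ) := h2.trans h4
  linarith

/-! ## Theorem 3 (Variance of empirical means, 2): unbounded diffusion constant -/

/-- The semigroup property of the averaging operator: `Pᴹ(Pᴺg) = P^{M+N}g`.
[cite: JoulinOllivier2010, §1.1 (the iterated averaging operator)] -/
theorem iterMean_iterMean (M N : ℕ) (g : X → ℝ) :
    ∀ x, iterMean P M (iterMean P N g) x = iterMean P (M + N) g x := by
  induction M with
  | zero => intro x; rw [iterMean_zero, Nat.zero_add]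
  | succ M ih =>
      intro x
      rw [iterMean_succ, show M + 1 + N = M + N + 1 by omega, iterMean_succ]
      exact sum_congr rfl fun z _ => by rw [ih z]

/-- `PᵏS(x) ≤ E_π S + (1 − κ)ᵏ C E(x)` for a `C`-Lipschitz `S`: the step "`PᵏS(x) ≤ C W₁(Pˣᵏ,π) + E_π S`
… `≤ C (1 − κ)ᵏ E(x) + E_π S`" of the proof of Theorem 3. [cite: JoulinOllivier2010, §4.2 proof of
Thm. 3 (the second and third inequalities of the last display)] -/
theorem iterMean_le_stationaryMean_add (hP : IsRowStochastic P) (hρ : ∀ a b, 0 ≤ ρ a b)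
    (hρ0 : ∀ a, ρ a a = 0) (hρpos : ∀ a b, a ≠ b → 0 < ρ a b) {κ : ℝ} (hκ1 : κ ≤ 1)
    (hκxy : ∀ x y, x ≠ y → κ ≤ coarseRicci ρ P x y) {π : X → ℝ} (hπ : ∀ a, 0 ≤ π a)
    (hπ1 : ∑ a, π a = 1) (hπP : IsStationary π P) {S : X → ℝ} {C : ℝ}
    (hSC : ∀ a b, |S a - S b| ≤ C * ρ a b) (hC : 0 ≤ C) (k : ℕ) (x : X) :
    iterMean P k S x ≤ (∑ y, π y * S y) + (1 - κ) ^ k * eccentricity ρ π x * C := by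
  have h := abs_iterMean_sub_stationaryMean_le hP hρ hρ0 hρpos hκ1 hκxy hπ hπ1 hπP hSC hC k x
  have h' := (abs_le.1 h).2
  linarith

/-- The no-burn-in mean `y ↦ E_y π̂₀(f) = T⁻¹ Σ_{k=1}^T Pᵏf(y)` is in fact `(1 − κ)L/(κT)`-Lipschitz
(`Σ_{k=1}^{T} (1 − κ)ᵏ ≤ (1 − κ)/κ`); this sharper form of `lipschitz_empMean` carries the factor
`(1 − κ)^{T₀}` of Theorem 3. [cite: JoulinOllivier2010, §4.2 proof of Thms. 2–3 (the constants
`s_k` and the factor `(1 − κ)^{T₀}` of the last display)] -/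
theorem lipschitz_empMean_sharp (hP : IsRowStochastic P) (hρ : ∀ a b, 0 ≤ ρ a b)
    (hρ0 : ∀ a, ρ a a = 0) (hρpos : ∀ a b, a ≠ b → 0 < ρ a b) {κ : ℝ} (hκ0 : 0 < κ) (hκ1 : κ ≤ 1)
    (hκxy : ∀ x y, x ≠ y → κ ≤ coarseRicci ρ P x y) {f : X → ℝ} {L : ℝ}
    (hf : ∀ a b, |f a - f b| ≤ L * ρ a b) (hL : 0 ≤ L) {T : ℕ} (hT : 0 < T) (a b : X) :
    |pathSum P T a (fun ω => (T : ℝ)⁻¹ * sumAlong T f ω) -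
        pathSum P T b (fun ω => (T : ℝ)⁻¹ * sumAlong T f ω)| ≤ (1 - κ) * L / (κ * T) * ρ a b := by
  have hT' : (0 : ℝ) < T := by exact_mod_cast hT
  rw [pathSum_const_mul'', pathSum_const_mul'', pathSum_sumAlong hP, pathSum_sumAlong hP, ← mul_sub,
    abs_mul, abs_of_pos (inv_pos.2 hT'), ← sum_sub_distrib]
  refine (mul_le_mul_of_nonneg_left (abs_sum_le_sum_abs _ _) (inv_nonneg.2 hT'.le)).trans ?_
  have h1 : ∑ k ∈ range T, |iterMean P (k + 1) f a - iterMean P (k + 1) f b| ≤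
      (∑ k ∈ range T, (1 - κ) ^ (k + 1)) * (L * ρ a b) := by
    rw [sum_mul]
    refine sum_le_sum fun k _ => ?_
    have := iterMean_lipschitz hP hρ hρ0 hρpos hκ1 hκxy hf (k + 1) a b
    linarith
  have h2 : ∑ k ∈ range T, (1 - κ) ^ (k + 1) ≤ (1 - κ) / κ := by
    have h := geom_sum_Ico_le_of_lt_one (m := 0) (n := T) (x := 1 - κ) (by linarith) (by linarith)
    rw [← range_eq_Ico, pow_zero, sub_sub_cancel] at h
    have e : ∑ k ∈ range T, (1 - κ) ^ (k + 1) = (1 - κ) * ∑ k ∈ range T, (1 - κ) ^ k := by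
      rw [mul_sum]; exact sum_congr rfl fun k _ => by ring
    rw [e, div_eq_mul_one_div]
    exact mul_le_mul_of_nonneg_left h (by linarith)
  calc (T : ℝ)⁻¹ * ∑ k ∈ range T, |iterMean P (k + 1) f a - iterMean P (k + 1) f b|
      ≤ (T : ℝ)⁻¹ * (((1 - κ) / κ) * (L * ρ a b)) :=
        mul_le_mul_of_nonneg_left (h1.trans (mul_le_mul_of_nonneg_right h2
          (mul_nonneg hL (hρ a b)))) (inv_nonneg.2 hT'.le)
    _ = (1 - κ) * L / (κ * T) * ρ a b := by field_simp

/-- `Σ_{k<N} (1 − κ)^{2(N−1−k)} (a + (1 − κ)ᵏ b) ≤ a/κ + (1 − κ)^{N−1} b/κ` for `a, b ≥ 0`, `N ≥ 1` —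
the two geometric sums of the proof of Theorem 3. [cite: JoulinOllivier2010, §4.2 proof of Thm. 3
(last two lines of the last display)] -/
theorem sum_geom_weights_le {κ : ℝ} (hκ0 : 0 < κ) (hκ1 : κ ≤ 1) {a b : ℝ} (ha : 0 ≤ a) (hb : 0 ≤ b)
    {N : ℕ} (hN : 0 < N) :
    ∑ k ∈ range N, (1 - κ) ^ (2 * (N - 1 - k)) * (a + (1 - κ) ^ k * b)
      ≤ a / κ + (1 - κ) ^ (N - 1) * b / κ := by
  set q : ℝ := 1 - κ with hq
  have hq0 : 0 ≤ q := by rw [hq]; linarith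
  have hq1 : q < 1 := by rw [hq]; linarith
  have hgeom : ∑ j ∈ range N, q ^ j ≤ 1 / κ := by
    have h := geom_sum_Ico_le_of_lt_one (m := 0) (n := N) hq0 hq1
    rw [← range_eq_Ico, pow_zero] at h
    rw [hq, sub_sub_cancel] at h
    rwa [hq]
  -- split the sum
  have hsplit : ∑ k ∈ range N, q ^ (2 * (N - 1 - k)) * (a + q ^ k * b)
      = (∑ k ∈ range N, (q ^ (N - 1 - k)) ^ 2) * a
        + (∑ k ∈ range N, q ^ (N - 1 - k)) * (q ^ (N - 1) * b) := by
    rw [sum_mul, sum_mul, ← sum_add_distrib]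
    refine sum_congr rfl fun k hk => ?_
    have hk' : k ≤ N - 1 := by have := mem_range.1 hk; omega
    have e1 : q ^ (2 * (N - 1 - k)) = (q ^ (N - 1 - k)) ^ 2 := by rw [← pow_mul, mul_comm]
    have e2 : q ^ (2 * (N - 1 - k)) * q ^ k = q ^ (N - 1 - k) * q ^ (N - 1) := by
      rw [← pow_add, ← pow_add]; congr 1; omega
    rw [mul_add, e1, ← mul_assoc, ← e1, e2]
    ring
  rw [hsplit]
  -- first sum: `(q^{j})² ≤ q^{j}`, and reflect
  have hA : ∑ k ∈ range N, (q ^ (N - 1 - k)) ^ 2 ≤ 1 / κ := by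
    calc ∑ k ∈ range N, (q ^ (N - 1 - k)) ^ 2 ≤ ∑ k ∈ range N, q ^ (N - 1 - k) :=
          sum_le_sum fun k _ => by
            rw [sq]
            exact mul_le_of_le_one_left (pow_nonneg hq0 _) (pow_le_one₀ hq0 hq1.le)
      _ = ∑ j ∈ range N, q ^ j := Finset.sum_range_reflect (fun j => q ^ j) N
      _ ≤ 1 / κ := hgeom
  have hB : ∑ k ∈ range N, q ^ (N - 1 - k) ≤ 1 / κ := by
    rw [Finset.sum_range_reflect (fun j => q ^ j) N]; exact hgeom
  have hqb : 0 ≤ q ^ (N - 1) * b := mul_nonneg (pow_nonneg hq0 _) hb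
  calc (∑ k ∈ range N, (q ^ (N - 1 - k)) ^ 2) * a + (∑ k ∈ range N, q ^ (N - 1 - k)) * (q ^ (N - 1) * b)
      ≤ 1 / κ * a + 1 / κ * (q ^ (N - 1) * b) :=
        add_le_add (mul_le_mul_of_nonneg_right hA ha) (mul_le_mul_of_nonneg_right hB hqb)
    _ = a / κ + q ^ (N - 1) * b / κ := by ring

/-- **THEOREM 3 (Variance of empirical means, 2), case `T₀ = 0`.** Assume `κ(x,y) ≥ κ > 0`, a
step-variance bound `σ(x)²/n_x` (any `S₀` with `IsStepVarianceBound ρ P S₀`) and a `C`-Lipschitz `S`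
with **`σ(x)²/(n_xκ) ≤ S(x)`**; `π` the invariant probability.  Then for an `L`-Lipschitz `f` and
`T ≥ 1`, **`Var_x π̂(f) ≤ (L²/(κT)) (E_π S + (C/(κT)) E(x))`** (eq. (7), first case).
[cite: JoulinOllivier2010, §1.2 Thm. 3, eq. (7) (case `T₀ = 0`); proof §4.2] -/
theorem JoulinOllivier2010_thm_3 (hP : IsRowStochastic P) (hρ : ∀ a b, 0 ≤ ρ a b)
    (hρ0 : ∀ a, ρ a a = 0) (hρpos : ∀ a b, a ≠ b → 0 < ρ a b) {κ : ℝ} (hκ0 : 0 < κ) (hκ1 : κ ≤ 1)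
    (hκxy : ∀ x y, x ≠ y → κ ≤ coarseRicci ρ P x y) {π : X → ℝ} (hπ : ∀ a, 0 ≤ π a)
    (hπ1 : ∑ a, π a = 1) (hπP : IsStationary π P) {S₀ : X → ℝ} (hS₀ : IsStepVarianceBound ρ P S₀)
    {S : X → ℝ} (hS : ∀ x, S₀ x ≤ κ * S x) {C : ℝ} (hSC : ∀ a b, |S a - S b| ≤ C * ρ a b)
    (hC : 0 ≤ C) {f : X → ℝ} {L : ℝ} (hf : ∀ a b, |f a - f b| ≤ L * ρ a b) (hL : 0 ≤ L) {T : ℕ}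
    (hT : 0 < T) (x : X) :
    empMeanVariance P T f x
      ≤ L ^ 2 / (κ * T) * ((∑ y, π y * S y) + C / (κ * T) * eccentricity ρ π x) := by
  have hT' : (0 : ℝ) < T := by exact_mod_cast hT
  set A : ℝ := ∑ y, π y * S y with hA
  set E : ℝ := eccentricity ρ π x with hE
  have hE0 : 0 ≤ E := by rw [hE, eccentricity]; exact sum_nonneg fun y _ => mul_nonneg (hρ x y) (hπ y)
  rw [empMeanVariance_eq]
  have h1 := sumVariance_le hP hρ hρ0 hρpos hκ0 hκ1 hκxy hS₀ hf hL T x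
  -- `PᵏS₀(x) ≤ κ PᵏS(x) ≤ κ (E_π S + (1 − κ)ᵏ E(x) C)`
  have hk : ∀ k, iterMean P k S₀ x ≤ κ * (A + (1 - κ) ^ k * E * C) := by
    intro k
    calc iterMean P k S₀ x ≤ iterMean P k (fun y => κ * S y) x := iterMean_mono hP k hS x
      _ = κ * iterMean P k S x := iterMean_const_mul k κ S x
      _ ≤ κ * (A + (1 - κ) ^ k * E * C) := mul_le_mul_of_nonneg_left
          (iterMean_le_stationaryMean_add hP hρ hρ0 hρpos hκ1 hκxy hπ hπ1 hπP hSC hC k x) hκ0.le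
  have hgeom : ∑ k ∈ range T, (1 - κ) ^ k ≤ 1 / κ := by
    have h := geom_sum_Ico_le_of_lt_one (m := 0) (n := T) (x := 1 - κ) (by linarith) (by linarith)
    rwa [← range_eq_Ico, pow_zero, sub_sub_cancel] at h
  have h2 : ∑ k ∈ range T, iterMean P k S₀ x ≤ κ * (T * A + E * C / κ) := by
    calc ∑ k ∈ range T, iterMean P k S₀ x ≤ ∑ k ∈ range T, κ * (A + (1 - κ) ^ k * E * C) :=
          sum_le_sum fun k _ => hk k
      _ = κ * (T * A + (∑ k ∈ range T, (1 - κ) ^ k) * (E * C)) := by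
          rw [← mul_sum, sum_add_distrib, sum_const, card_range, nsmul_eq_mul, sum_mul]
          congr 2
          exact sum_congr rfl fun k _ => by ring
      _ ≤ κ * (T * A + 1 / κ * (E * C)) :=
          mul_le_mul_of_nonneg_left (add_le_add le_rfl (mul_le_mul_of_nonneg_right hgeom
            (mul_nonneg hE0 hC))) hκ0.le
      _ = κ * (T * A + E * C / κ) := by ring
  calc (T : ℝ)⁻¹ ^ 2 * sumVariance P T f x ≤ (T : ℝ)⁻¹ ^ 2 * ((L / κ) ^ 2 * (κ * (T * A + E * C / κ))) :=
        mul_le_mul_of_nonneg_left (h1.trans (mul_le_mul_of_nonneg_left h2 (sq_nonneg _)))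
          (sq_nonneg _)
    _ = L ^ 2 / (κ * T) * (A + C / (κ * T) * E) := by field_simp

/-- `Pᴺ` commutes with finite sums of functions. [cite: JoulinOllivier2010, §1.1 (the averaging
operator is linear)] -/
theorem iterMean_finset_sum (N : ℕ) (s : Finset ℕ) (g : ℕ → X → ℝ) (x : X) :
    iterMean P N (fun y => ∑ k ∈ s, g k y) x = ∑ k ∈ s, iterMean P N (g k) x := by
  unfold iterMean
  simp_rw [mul_sum]
  rw [sum_comm]

/-- **THEOREM 3 (Variance of empirical means, 2), general burn-in `T₀ ≥ 1`.** Under the hypotheses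
of `JoulinOllivier2010_thm_3`, **`Var_x π̂(f) ≤ (L²/(κT)) ((1 + 1/(κT)) E_π S + (2C(1 − κ)^{T₀}/(κT))
E(x))`** (eq. (7), second case). [cite: JoulinOllivier2010, §1.2 Thm. 3, eq. (7) (case `T₀ ≠ 0`);
proof §4.2 (last display)] -/
theorem JoulinOllivier2010_thm_3_burnIn (hP : IsRowStochastic P) (hρ : ∀ a b, 0 ≤ ρ a b)
    (hρ0 : ∀ a, ρ a a = 0) (hρpos : ∀ a b, a ≠ b → 0 < ρ a b) {κ : ℝ} (hκ0 : 0 < κ) (hκ1 : κ ≤ 1)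
    (hκxy : ∀ x y, x ≠ y → κ ≤ coarseRicci ρ P x y) {π : X → ℝ} (hπ : ∀ a, 0 ≤ π a)
    (hπ1 : ∑ a, π a = 1) (hπP : IsStationary π P) {S₀ : X → ℝ} (hS₀ : IsStepVarianceBound ρ P S₀)
    {S : X → ℝ} (hS : ∀ x, S₀ x ≤ κ * S x) {C : ℝ} (hSC : ∀ a b, |S a - S b| ≤ C * ρ a b)
    (hC : 0 ≤ C) {f : X → ℝ} {L : ℝ} (hf : ∀ a b, |f a - f b| ≤ L * ρ a b) (hL : 0 ≤ L)
    {T₀ : ℕ} (hT₀ : 0 < T₀) {T : ℕ} (hT : 0 < T) (x : X) :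
    empMeanVarianceBurnIn P T₀ T f x
      ≤ L ^ 2 / (κ * T) * ((1 + 1 / (κ * T)) * (∑ y, π y * S y)
          + 2 * C * (1 - κ) ^ T₀ / (κ * T) * eccentricity ρ π x) := by
  have hT' : (0 : ℝ) < T := by exact_mod_cast hT
  set A : ℝ := ∑ y, π y * S y with hA
  set E : ℝ := eccentricity ρ π x with hE
  set q : ℝ := 1 - κ with hq
  have hq0 : 0 ≤ q := by rw [hq]; linarith
  have hq1 : q ≤ 1 := by rw [hq]; linarith
  have hE0 : 0 ≤ E := by
    rw [hE, eccentricity]; exact sum_nonneg fun y _ => mul_nonneg (hρ x y) (hπ y)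
  have hA0 : 0 ≤ A := by
    rw [hA]
    refine sum_nonneg fun y _ => mul_nonneg (hπ y) ?_
    exact (mul_nonneg_iff_of_pos_left hκ0).1 ((hS₀.nonneg hρ y).trans (hS y))
  have hEC : 0 ≤ E * C := mul_nonneg hE0 hC
  -- `PᵏS₀(x) ≤ κ (E_π S + qᵏ E(x) C)` for every `k`
  have hk : ∀ k, iterMean P k S₀ x ≤ κ * (A + q ^ k * (E * C)) := by
    intro k
    calc iterMean P k S₀ x ≤ iterMean P k (fun y => κ * S y) x := iterMean_mono hP k hS x
      _ = κ * iterMean P k S x := iterMean_const_mul k κ S x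
      _ ≤ κ * (A + (1 - κ) ^ k * E * C) := mul_le_mul_of_nonneg_left
          (iterMean_le_stationaryMean_add hP hρ hρ0 hρpos hκ1 hκxy hπ hπ1 hπP hSC hC k x) hκ0.le
      _ = κ * (A + q ^ k * (E * C)) := by rw [hq]; ring
  have hgeom : ∑ j ∈ range T, q ^ j ≤ 1 / κ := by
    have h := geom_sum_Ico_le_of_lt_one (m := 0) (n := T) (x := q) hq0 (by rw [hq]; linarith)
    rw [← range_eq_Ico, pow_zero] at h
    rw [hq, sub_sub_cancel] at h
    rwa [hq]
  rw [empMeanVarianceBurnIn_eq]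
  -- TERM 1: `P^{T₀}(Var_· π̂₀(f))(x) ≤ T⁻²(L/κ)² Σ_{k<T} P^{T₀+k}S₀(x)`
  have hpt : ∀ y, empMeanVariance P T f y
      ≤ (T : ℝ)⁻¹ ^ 2 * ((L / κ) ^ 2 * ∑ k ∈ range T, iterMean P k S₀ y) := by
    intro y
    rw [empMeanVariance_eq]
    exact mul_le_mul_of_nonneg_left (sumVariance_le hP hρ hρ0 hρpos hκ0 hκ1 hκxy hS₀ hf hL T y)
      (sq_nonneg _)
  have hT1a : iterMean P T₀ (empMeanVariance P T f) x
      ≤ (T : ℝ)⁻¹ ^ 2 * ((L / κ) ^ 2 * ∑ k ∈ range T, iterMean P (T₀ + k) S₀ x) := by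
    refine (iterMean_mono hP T₀ hpt x).trans (le_of_eq ?_)
    rw [iterMean_const_mul, iterMean_const_mul, iterMean_finset_sum]
    congr 2
    exact sum_congr rfl fun k _ => iterMean_iterMean T₀ k S₀ x
  have hsum1 : ∑ k ∈ range T, iterMean P (T₀ + k) S₀ x ≤ κ * (T * A + q ^ T₀ * (E * C) / κ) := by
    calc ∑ k ∈ range T, iterMean P (T₀ + k) S₀ x ≤ ∑ k ∈ range T, κ * (A + q ^ (T₀ + k) * (E * C)) :=
          sum_le_sum fun k _ => hk (T₀ + k)
      _ = κ * (T * A + q ^ T₀ * (E * C) * ∑ k ∈ range T, q ^ k) := by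
          rw [← mul_sum]
          congr 1
          rw [sum_add_distrib, sum_const, card_range, nsmul_eq_mul]
          congr 1
          rw [mul_sum]
          exact sum_congr rfl fun k _ => by rw [pow_add]; ring
      _ ≤ κ * (T * A + q ^ T₀ * (E * C) * (1 / κ)) :=
          mul_le_mul_of_nonneg_left (add_le_add le_rfl (mul_le_mul_of_nonneg_left hgeom
            (mul_nonneg (pow_nonneg hq0 _) hEC))) hκ0.le
      _ = κ * (T * A + q ^ T₀ * (E * C) / κ) := by ring
  have hT1 : iterMean P T₀ (empMeanVariance P T f) x
      ≤ L ^ 2 * A / (κ * T) + L ^ 2 * (q ^ T₀ * (E * C)) / (κ ^ 2 * T ^ 2) := by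
    refine hT1a.trans ?_
    calc (T : ℝ)⁻¹ ^ 2 * ((L / κ) ^ 2 * ∑ k ∈ range T, iterMean P (T₀ + k) S₀ x)
        ≤ (T : ℝ)⁻¹ ^ 2 * ((L / κ) ^ 2 * (κ * (T * A + q ^ T₀ * (E * C) / κ))) :=
          mul_le_mul_of_nonneg_left (mul_le_mul_of_nonneg_left hsum1 (sq_nonneg _)) (sq_nonneg _)
      _ = L ^ 2 * A / (κ * T) + L ^ 2 * (q ^ T₀ * (E * C)) / (κ ^ 2 * T ^ 2) := by
          field_simp
  -- TERM 2: Lemma 9 at `N = T₀` for the `(1−κ)L/(κT)`-Lipschitz mean `y ↦ E_y π̂₀(f)`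
  have h2 := JoulinOllivier2010_lemma_9 hP hρ hρ0 hρpos hκ1 hκxy hS₀
    (lipschitz_empMean_sharp hP hρ hρ0 hρpos hκ0 hκ1 hκxy hf hL hT)
    (div_nonneg (mul_nonneg hq0 hL) (mul_nonneg hκ0.le hT'.le)) T₀ x
  have hsum2 : ∑ k ∈ range T₀, (1 - κ) ^ (2 * (T₀ - 1 - k)) * iterMean P k S₀ x
      ≤ A + q ^ (T₀ - 1) * (E * C) := by
    calc ∑ k ∈ range T₀, (1 - κ) ^ (2 * (T₀ - 1 - k)) * iterMean P k S₀ x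
        ≤ ∑ k ∈ range T₀, q ^ (2 * (T₀ - 1 - k)) * (κ * (A + q ^ k * (E * C))) :=
          sum_le_sum fun k _ => by
            rw [← hq]; exact mul_le_mul_of_nonneg_left (hk k) (pow_nonneg hq0 _)
      _ = κ * ∑ k ∈ range T₀, q ^ (2 * (T₀ - 1 - k)) * (A + q ^ k * (E * C)) := by
          rw [mul_sum]; exact sum_congr rfl fun k _ => by ring
      _ ≤ κ * (A / κ + q ^ (T₀ - 1) * (E * C) / κ) :=
          mul_le_mul_of_nonneg_left (by
            have h := sum_geom_weights_le hκ0 hκ1 hA0 hEC hT₀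
            rwa [← hq] at h) hκ0.le
      _ = A + q ^ (T₀ - 1) * (E * C) := by field_simp
  have hT2 : iterMean P T₀ (fun y => pathSum P T y (fun ω => (T : ℝ)⁻¹ * sumAlong T f ω) ^ 2) x -
      iterMean P T₀ (fun y => pathSum P T y (fun ω => (T : ℝ)⁻¹ * sumAlong T f ω)) x ^ 2
      ≤ L ^ 2 * A / (κ ^ 2 * T ^ 2) + L ^ 2 * (q ^ T₀ * (E * C)) / (κ ^ 2 * T ^ 2) := by
    refine (h2.trans (mul_le_mul_of_nonneg_left hsum2 (sq_nonneg _))).trans ?_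
    rw [← hq]
    -- `(qL/(κT))² (A + q^{T₀−1} EC) = (L²/(κ²T²)) (q²A + q^{T₀+1} EC) ≤ (L²/(κ²T²)) (A + q^{T₀} EC)`
    have hq2A : q ^ 2 * A ≤ A := by
      have : q ^ 2 ≤ 1 := pow_le_one₀ hq0 hq1
      nlinarith
    have hqT : q ^ 2 * q ^ (T₀ - 1) * (E * C) ≤ q ^ T₀ * (E * C) := by
      have e1 : q ^ 2 * q ^ (T₀ - 1) = q ^ T₀ * q := by
        rw [← pow_add, ← pow_succ]; congr 1; omega
      rw [e1]
      have : q ^ T₀ * q * (E * C) ≤ q ^ T₀ * 1 * (E * C) :=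
        mul_le_mul_of_nonneg_right (mul_le_mul_of_nonneg_left hq1 (pow_nonneg hq0 _)) hEC
      linarith
    have hκT : (0 : ℝ) < κ ^ 2 * T ^ 2 := by positivity
    rw [show (q * L / (κ * T)) ^ 2 * (A + q ^ (T₀ - 1) * (E * C))
        = L ^ 2 * (q ^ 2 * A + q ^ 2 * q ^ (T₀ - 1) * (E * C)) / (κ ^ 2 * T ^ 2) by
          field_simp,
      ← add_div, div_le_div_iff_of_pos_right hκT, ← mul_add]
    exact mul_le_mul_of_nonneg_left (add_le_add hq2A hqT) (sq_nonneg _)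
  have e : L ^ 2 / (κ * T) * ((1 + 1 / (κ * T)) * A + 2 * C * (1 - κ) ^ T₀ / (κ * T) * E)
      = (L ^ 2 * A / (κ * T) + L ^ 2 * (q ^ T₀ * (E * C)) / (κ ^ 2 * T ^ 2))
        + (L ^ 2 * A / (κ ^ 2 * T ^ 2) + L ^ 2 * (q ^ T₀ * (E * C)) / (κ ^ 2 * T ^ 2)) := by
    rw [hq]; field_simp; ring
  rw [e]
  exact add_le_add hT1 hT2

end PathFunctionals


end Literature.Probability.MarkovChains
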